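import Literature.MathematicalPhysics.QuantumFieldTheory.Balaban1983to89.T4TermwiseBoundary

/-!
# T⁴ continuum, node U5 (NE7), TERM-WISE member — THE 𝐑-KIND AS THE THIRD RATE-MATCHED KIND: the R-operation terms
# (2.30) centred at ZERO by size ⊕ rate ⊕ the reference witness, their radius PRODUCED and summable from the coupling
# flow; the radii (R) and the centring (R′) asked of the RESIDUAL-PROPER kind only

Lineage t4-ne7-p1 (term-wise matching modulo constants), generation 7.  HONEST FRAMING (page 1): pure YM₄ on a FIXED
FINITE torus T⁴, rung (B)+1 of the cell's ladder = the `ε → 0` limit of expectations of gauge-invariant observables; NOT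
infinite volume, NOT a mass gap, NOT the Clay problem.  Spine estimate NE7 (node U5: for every `K` a `t`-independent
constant `c_K` with `|log Z^B_{K+1}(t) − log Z^A_K(t) − c_K| ≤ δ_K·|T₁|`, `Σ_K δ_K < ∞`) is NOT PRINTED for Bałaban's
d = 4 procedure; its d = 2, 3 template is [King1986] (3.10)–(3.13) pp. 656–657 (TEMPLATE ONLY).  Every estimate below is
a HYPOTHESIS BINDER named in the statement; nothing of Bałaban's expansions is asserted; no conditional is hidden — the
flow window (0.31) of [Balaban1987RG1] (the cell's BetaPertH road; tree `Step.Discrete031`) enters BY NAME as the binders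
`h031A`/`h031B`/`h031` of §2, §4, §5, and (B), (B^μ) sit by name inside the producers of the other binders exactly where
those modules declare them.  All declarations are [folklore] bookkeeping (composition of tree theorems, finite sums,
`Real.log`/`Real.exp`, comparison of series).  NO definitions, no cite tags.

## Why this leaf (record `t4/T4-EST-NE7-P1.md` v6.1 §10: after generation 6 the wall of the term-wise route is the pair
## of binders (R)(R′) on the RESIDUAL kind)
Generation 6 (`T4TermwiseBoundary`) opened the other-kind factors of a term into boundary × one-sided × constant ×
residual groups, rate-matched the boundary group along the tower and merged the one-sided and constant groups, leaving
(R) a log-ratio radius `RR ≤ vol·rR_K`, `Σ rR < ∞`, about a centre `cR_K(t,τ)`, and (R′) the centring `|cR − c₀_K| ≤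
vol·s_K`, `Σ s < ∞`, asked of the RESIDUAL group `r^A`, `r^B` = {R-operation terms, the running-coupling counter-term
pairing (record note I2), `t`- or `τ`-dependent normalisations, node U5a's characteristic functions}.  The largest located
piece of that group is the 𝐑-KIND: print, ONE run, [Balaban1988Convergent] p. 260 — «The term R_k has the renormalization
similar to (2.25): 𝐑_k(U_k) = Σ_{j=1}^{k} [𝐑^{(j)}(Λ_j, U_k) − 𝐑^{(j)}(Λ_j, 1)] . (2.30)», each `𝐑^{(j)}(Λ_j, U_k)` a sum
over localization domains `X ∈ 𝐃_j` of terms with «the properties (i)–(iii) formulated above, after (2.27)» and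
«|𝐑^{(j)}(X,(𝐔,𝐉))| ≦ g_j^{κ₀} exp(−κd_j(X)) . (2.31) Here κ₀ can be chosen arbitrarily large, similarly as κ, if the
other parameters are fixed properly, as in [I]. … After the vacuum energy renormalization we obtain a sum of marginal
terms, i.e., terms with bounds O(1)(L^jη)⁴g_j^{κ₀} exp(−κd_j(X)). The sum over X is controlled by the exponential factor,
and by the factor (L^jη)⁴. The sum over j is controlled by g_j^{κ₀}.»; and Theorem 2 p. 263, (2.44) `|Σ_{X∈𝐃_j, X⊂Λ_j,
X∩Ω≠∅}[𝐑^{(j)}(X, U_k) − 𝐑^{(j)}(X, 1)]| ≦ R_1 g_j^{κ₀} Σ_{n=j}^{k} |Γ_n∩Ω|`, «The volumes are taken in the corresponding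
scales», (2.46) «for κ₀ ≧ 7 and g sufficiently small.» (all transcribed in `T4GoodClassBudget`'s header; LOCATIONS of
one-run shapes, not citations of any binder below).  So the 𝐑-kind has EXACTLY the factor format of the E-group —
`exp(𝐑^{(j)}(X; g, U_k(v)) − 𝐑^{(j)}(X; g, 1))` per domain — with a one-run SIZE that is a bound on the DIFFERENCE itself
(centre ZERO, no counter-term) and tiny in the coupling at the creation scale, `R₁ g_j^{κ₀}` per unit final volume.  This
leaf splits the residual group `r = ρ·r′`, `ρ` = the 𝐑-GROUP `∏_{X∈rfac} exp(𝐑(X; g, U(v)) − 𝐑(X; g, 1))`, and treats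
`ρ` by kernel, IN TECHNIQUE ("δ_K from NE2–NE5's rates composed along the tower, summability from the geometric factors"):
* per creation-scale slice `j ≤ K` the two-run log-ratio of the 𝐑-group is within the SIZE radius
  `vol·R₁·(g^A_{K,j}^{κ₀} + g^B_{K,j}^{κ₀})` OF ZERO (the two runs' one-run bounds of the (2.44) all-regular shape, binders
  (R-S); §1 also PRODUCES (R-S) from the factor-level marginal shape of the sentence p. 260 — `(L^jη)⁴ = Λ^{−(K−j)}` for
  `η = L^{−K}`, `Λ = L⁴` — and multiplicity) AND within the RATE radius `Cw·vol·(C_R θ′^j Λ^{K−j})` of the rate centre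
  `Σ_{scale X = j} −(𝐑^B(X; g^B, U₁^B) − 𝐑^A(X; g^A, U₁^A))` (generation 3's `T4TermwiseBudget.rateSlice_of_uRateUpTo`
  VERBATIM on a two-run 𝐑-RATE FAMILY (R-T) `URateUpTo K RA RB …` — node U3's output for the 𝐑-functionals, NOT PRINTED,
  consumed here as a binder family exactly as generation 6 consumed the boundary family (B-T); §5 produces it from
  node-U3-type shapes for the 𝐑-functionals by generation 5's `T4TermwiseCurrency.uRateUpTo_of_nodesT` VERBATIM — those
  shapes are themselves NOT PRINTED), and the rate centre bounds zero at the E-group's REFERENCE WITNESS (F′)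
  (`T4TermwiseDeviation.rateCentre_abs_le_of_witness` BY NAME — the same witness `U^A(v₁) = U₁^A`, `U^B(v₁) = U₁^B`, no new
  binder).  Hence the 𝐑-group's log-ratio is within `Σ_{j ≤ K} min(S_j, 2ρ_j) ≤ vol·rρ_K` OF ZERO,
  `rρ_K = max(2Cw,1)·Σ_{j+n=K}[min(R₁ g^A_{K,j}^{κ₀}, C_R θ′^jΛⁿ) + min(R₁ g^B_{K,j}^{κ₀}, C_R θ′^jΛⁿ)]`: the 𝐑-kind has NO
  share in (R′) (no centring hazard: its centre IS zero) and its share of (R) is PRODUCED;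
* `Σ_K rρ_K < ∞` — "summability from the geometric factors": recent slices are paid by the rate `θ′^j`, old slices by the
  coupling at the creation scale through the LOWER half of the flow window (0.31) p. 259 of [Balaban1987RG1] in both
  runs (`Step.Discrete031`, the cell's BetaPertH-road conditional, BY NAME; run B's window is run A's at cutoff `K+1`
  re-indexed, §0) and `κ₀ > 4` — `T4Crossover.summable_sum_min_coupling` / generation 1's
  `T4TowerRateComposition.summable_sum_min_coupling_poly` BY NAME.  The R-branch of `T4Crossover.crossoverDelta` has been
  in the tree since the cell's first T⁴ leaves as an ABSTRACT per-unit-volume majorant ("`SZ_j = R₁ gs K j^{κ₀}`: literally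
  the R-branch", `T4GoodClassBudget.sum_min_le_crossoverShape`) with no ledger instance in the term-wise route
  (generation 3 booked the 𝐑-kind inside (O)); THIS is its instance;
* the residual-proper group `r′` keeps (R)+(R′): THIS is the wall of the term-wise route after generation 7, stated as the
  binders `hrpos hR hRR hrR hdevR` of §5 (main action / running-coupling counter-term pairing = interface note I2,
  `t`- or `τ`-dependent normalisations, node U5a's characteristic-function mismatch).
NOT re-opened (record (10d)(iii)): producing the 𝐑-rate family inside this route — it is CONSUMED, by name.

## What this module adds (additive leaf; imports `T4TermwiseBoundary` (gen 6) BY NAME; nothing upstream is edited)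
§0 `discrete031_reindex` — run B's flow window from run A's at the next cutoff.
§1 `rSliceSize_of_marginal` (factor-level marginal shape + multiplicity ⇒ the slice size (R-S)), `rSlice_abs_le_size`
   (two runs' one-run slice sizes ⇒ the two-run slice within their sum OF ZERO), `abs_sum_le_sum_min_of_slices` (real
   analysis: a ledger whose every slice obeys two radii about zero is within `Σ_j min` of zero), `rGroup_logRatio_le` (the
   𝐑-group of one term: centre `0`, radius `Σ_{j≤K} min(S_j, 2ρ_j)`, from (R-S), (R-T), (M-R) and the witness),
   `min_add_le_add_min`, `rRadius_le` (`… ≤ vol·rρ_K`).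
§2 `summable_rRadius`, `summable_rRadius_poly` — `Σ_K rρ_K < ∞` from (0.31) in both runs and `κ₀ > 4` (constant, resp.
   polynomially growing, rate constant).
§3 `residual_split_pointwise` — the algebra of `r = ρ·r′` (centres: `0 + cR′`; radii add).
§4 `goodClause_summable_of_kindsR_witness` — generation 6's `goodClause_summable_of_kinds_witness` with the residual split,
   (R)(R′) asked of `r′` only; explicit `δ″_K`, `Summable δ″`.
§5 `hasContinuumLimit_of_kindsR_rate_witness` (given the E-, boundary- and 𝐑-rate families) and
   `hasContinuumLimit_of_kindsR_nodesT` (END TO END from the nodes on the t-currency towers, the 𝐑-tower included): node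
   U0's three targets `HasContinuumLimit Sc ∧ HasUniqueLimitPoints Sc ∧ LimitPointsAgree Sc`.
§6 `toy_rKind_nonvacuous` — §1's binders jointly inhabited with the two runs' 𝐑-terms DIFFERENT and background-dependent;
   the produced radius bounds the genuine nonzero log-ratio.  No physics.

## Binder census of `hasContinuumLimit_of_kindsR_nodesT` (every one a hypothesis; which are estimates)
As generation 6's `hasContinuumLimit_of_kinds_nodesT` (its census (T)(B-T)(F)(F′)(S)(M)(M-B)(B-adm)(B-win)(N)(Q)(W)(L1-pos)
(E1/E2) unchanged, the format (F) written with FIVE groups), with generation 6's (R)(R′) REPLACED by: (R-T) the 𝐑-tower,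
string-independent, NOT PRINTED — `h9R hΛR hωR hULR hGR hPR h5R hθ₅R hC₅R` on a t-window `WR`, `htAR htBR`, `max(ωR,θc) < θ′`,
`θ₅R ≤ θ′`; (R-sc) `hrsc` creation scales of the 𝐑-pieces `≤ K` and (M-R) `hMR` their multiplicity (STRUCTURAL / NOT
PRINTED for a two-run ledger, as (M)); (R-S) `hRSA hRSB` the one-run slice sizes `vol·R₁·g_{K,j}^{κ₀}` (the all-regular part
of (2.44), one run at a time — LOCATED, NOT PRINTED as typed for the synchronised structures; the parts `n < k` are not in
this majorant, as for (S)); (0.31) `hb h031 hgpos` the flow window of the coupling tables at every cutoff (the BetaPertH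
road, BY NAME) with `hR₁`, `hκ₀ : 4 < κ₀`; (R-res′) `hrpos hR hRR hrR` and (R′-res′) `hdevR` — radii and centring of the
RESIDUAL-PROPER kind, NOT PRINTED: THE WALL.  Numeric side conditions carried from generation 6: `1 ≤ Λ` (`Λ = L⁴`, the
declared regime of `Multiplicity`), `0 ≤ Cl` (the log window's constant).  OUTPUT: node U0's three targets.

## What is NOT delivered
Any producer of (T), (B-T), (R-T)'s shapes, of (S), (R-S), (N), (R-res′), (R′-res′), (W), or of (0.31); the booking of the
running-coupling counter-terms `−β_j(g_{j−1})A` against the main action (interface note I2 — it stays with the format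
instantiator); anything about print.

References (LOCATIONS / TEMPLATE only; nothing here is cited as proving a binder): [King1986] C. King, The U(1) Higgs
model: I. The continuum limit, Commun. Math. Phys. 102 (1986) 649–677, (3.10)–(3.13) pp. 656–657 (template of NE7);
[Balaban1988Convergent] T. Bałaban, Convergent renormalization expansions for lattice gauge theories, Commun. Math. Phys.
119 (1988) 243–285, (2.30)–(2.31) p. 260, Theorem 2 (2.44), (2.46) p. 263 (locations of the one-run shapes of the 𝐑-kind);
[Balaban1987RG1] T. Bałaban, Renormalization group approach to lattice gauge field theories. I, Commun. Math. Phys. 109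
(1987) 249–301, (0.31) p. 259 (the flow window, tree `Step.Discrete031`), (0.26) p. 257 (domain counting, binder (M-R)).
-/

open Finset MeasureTheory _root_.Filter _root_.Topology

namespace Literature.MathematicalPhysics.QuantumFieldTheory.Balaban1983to89.T4TermwiseResidual

open T4OutputRate T4RecentScale T4GoodClassBudget T4CauchySum T4Crossover T4TowerRateComposition T4TowerRateDischarge
open T4BoundaryCarrier (BFunctional atFl NE9Fl LipBackgroundFl NE5B)
open T4CurrencyMatching (invSq couplingRateT_of_injectedDisc)
open T4TermwiseBudget T4TermwiseDeviation T4TermwiseCurrency T4TermwiseBoundary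

/-! ## §0 Run B's flow window: (0.31) at cutoff `K+1`, re-indexed -/

/-- (0.31) at cutoff `K+1` for a table `gs` gives (0.31) at cutoff `K` for the re-indexed table `j ↦ gs (j+1)` with the same
endpoint and slopes (`(K+1) − (j+1) = K − j`): run B's coupling table in run A's numbering. [folklore] -/
theorem discrete031_reindex {b β' g : ℝ} {K : ℕ} {gs : ℕ → ℝ} (h : Step.Discrete031 b β' (K + 1) g gs) :
    Step.Discrete031 b β' K g (fun j => gs (j + 1)) := by
  intro k hk
  have h' := h (k + 1) (by omega)
  have e : ((K + 1 : ℕ) : ℝ) - ((k + 1 : ℕ) : ℝ) = (K : ℝ) - k := by push_cast; ring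
  rwa [e] at h'

/-! ## §1 The 𝐑-kind of ONE term: centre ZERO, radius `Σ_{j ≤ K} min(size, 2·rate)` -/

section RKind

variable {C : Carriers} {V : Type*}

/-- **THE SLICE SIZE (R-S) PRODUCED FROM THE FACTOR-LEVEL MARGINAL SHAPE.**  If every 𝐑-piece of the term obeys, in ONE
run and at the given background, the marginal shape of the sentence p. 260 of [Balaban1988Convergent] —
`|𝐑(X; g, U) − 𝐑(X; g, 1)| ≤ R₁·g_{scale X}^{κ₀}·(Λ^{K − scale X})⁻¹·e^{−κ dX}` (`(L^jη)⁴ = Λ^{−(K−j)}`; a HYPOTHESIS — print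
states it for one run and regular configurations) — and the pieces have multiplicity `Cw·vol·Λ^{K−j}` per slice
(`T4RecentScale.Multiplicity`, NOT PRINTED for a two-run ledger), then the scale-`j` slice of `Σ_X (𝐑(X; g, U) − 𝐑(X; g, 1))`
has absolute value at most `vol·((Cw·R₁)·g_j^{κ₀})` — the all-regular part of (2.44) p. 263 with constant `Cw·R₁`.
[folklore] -/
theorem rSliceSize_of_marginal {Bg : Type} {R : Functional C Bg} {g : ℕ → ℝ} {U one : Bg} {rfac : Finset C.Dom}
    {K : ℕ} {R₁ Λ κ Cw vol : ℝ} {gs : ℕ → ℝ} {κ₀ : ℕ}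
    (hmarg : ∀ X ∈ rfac, |R g U X - R g one X|
      ≤ R₁ * gs (C.scale X) ^ κ₀ * (Λ ^ (K - C.scale X))⁻¹ * Real.exp (-(κ * C.d X)))
    (hM : Multiplicity rfac C.scale (fun X => Real.exp (-(κ * C.d X))) Cw vol Λ K) (hΛ : 0 < Λ) (hR₁ : 0 ≤ R₁)
    (hgs : ∀ j ≤ K, 0 ≤ gs j) {j : ℕ} (hj : j ≤ K) :
    |∑ X ∈ rfac with C.scale X = j, (R g U X - R g one X)| ≤ vol * ((Cw * R₁) * gs j ^ κ₀) := by
  have hc0 : 0 ≤ R₁ * gs j ^ κ₀ * (Λ ^ (K - j))⁻¹ :=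
    mul_nonneg (mul_nonneg hR₁ (pow_nonneg (hgs j hj) _)) (inv_nonneg.mpr (pow_nonneg hΛ.le _))
  calc |∑ X ∈ rfac with C.scale X = j, (R g U X - R g one X)|
      ≤ ∑ X ∈ rfac with C.scale X = j, |R g U X - R g one X| := abs_sum_le_sum_abs _ _
    _ ≤ ∑ X ∈ rfac with C.scale X = j, R₁ * gs j ^ κ₀ * (Λ ^ (K - j))⁻¹ * Real.exp (-(κ * C.d X)) :=
        sum_le_sum fun X hX => by
          have hXj : C.scale X = j := (mem_filter.mp hX).2
          have h := hmarg X (mem_filter.mp hX).1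
          rwa [hXj] at h
    _ = R₁ * gs j ^ κ₀ * (Λ ^ (K - j))⁻¹ * ∑ X ∈ rfac with C.scale X = j, Real.exp (-(κ * C.d X)) := by
        rw [mul_sum]
    _ ≤ R₁ * gs j ^ κ₀ * (Λ ^ (K - j))⁻¹ * (Cw * vol * Λ ^ (K - j)) := mul_le_mul_of_nonneg_left (hM j hj) hc0
    _ = vol * ((Cw * R₁) * gs j ^ κ₀) * ((Λ ^ (K - j))⁻¹ * Λ ^ (K - j)) := by ring
    _ = vol * ((Cw * R₁) * gs j ^ κ₀) := by rw [inv_mul_cancel₀ (pow_ne_zero _ hΛ.ne'), mul_one]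

/-- **THE TWO-RUN SLICE OF THE 𝐑-GROUP IS WITHIN THE SUM OF THE ONE-RUN SIZES OF ZERO.**  The 𝐑-pieces carry their
vacuum-energy subtraction and NO counter-term («It explains why coupling constant renormalization counterterms are not needed
in (2.30)», p. 260), so the one-run size bounds (R-S) — run A's slice within `S^A` of zero, run B's within `S^B` of zero —
put the slice of `log f^B − log f^A` over the (2.30)-shaped factors `f = exp(𝐑(X; g, U(v)) − 𝐑(X; g, 1))` within `S^A + S^B`
OF ZERO. [folklore] -/
theorem rSlice_abs_le_size {RA : Functional C C.BgA} {RB : Functional C C.BgB} {gA gB : ℕ → ℝ} {UA oneA : C.BgA}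
    {UB oneB : C.BgB} {rfac : Finset C.Dom} {j : ℕ} {SA SB : ℝ}
    (hA : |∑ X ∈ rfac with C.scale X = j, (RA gA UA X - RA gA oneA X)| ≤ SA)
    (hB : |∑ X ∈ rfac with C.scale X = j, (RB gB UB X - RB gB oneB X)| ≤ SB) :
    |∑ X ∈ rfac with C.scale X = j,
        (Real.log (Real.exp (RB gB UB X - RB gB oneB X)) - Real.log (Real.exp (RA gA UA X - RA gA oneA X)))|
      ≤ SA + SB := by
  simp only [Real.log_exp]
  rw [sum_sub_distrib, add_comm SA SB]
  exact (abs_sub _ _).trans (add_le_add hB hA)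

/-- REAL ANALYSIS: if every creation-scale slice `j ≤ K` of a finite ledger `x` (all scales `≤ K`) has absolute value at
most `S j` AND at most `T j`, the whole ledger sum has absolute value at most `Σ_{j ≤ K} min(S j, T j)`. [folklore] -/
theorem abs_sum_le_sum_min_of_slices {ι : Type*} {fac : Finset ι} {sc : ι → ℕ} {x : ι → ℝ} {K : ℕ} {S T : ℕ → ℝ}
    (hsc : ∀ i ∈ fac, sc i ≤ K) (hS : ∀ j ≤ K, |∑ i ∈ fac with sc i = j, x i| ≤ S j)
    (hT : ∀ j ≤ K, |∑ i ∈ fac with sc i = j, x i| ≤ T j) :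
    |∑ i ∈ fac, x i| ≤ ∑ j ∈ range (K + 1), min (S j) (T j) := by
  have hmaps : ∀ i ∈ fac, sc i ∈ range (K + 1) := fun i hi => mem_range.mpr (Nat.lt_succ_of_le (hsc i hi))
  rw [← sum_fiberwise_of_maps_to hmaps x]
  refine (abs_sum_le_sum_abs _ _).trans (sum_le_sum fun j hj => ?_)
  have hjK : j ≤ K := Nat.le_of_lt_succ (mem_range.mp hj)
  exact le_min (hS j hjK) (hT j hjK)

/-- The 𝐑-group of a term is a product of exponentials, hence positive. [folklore] -/
theorem rGroup_pos {Bg : Type} (R : Functional C Bg) (g : ℕ → ℝ) (U one : Bg) (rfac : Finset C.Dom) :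
    0 < ∏ X ∈ rfac, Real.exp (R g U X - R g one X) :=
  prod_pos fun _ _ => Real.exp_pos _

/-- **THE 𝐑-GROUP'S LOG-RATIO IS CENTRED AT ZERO WITHIN `Σ_{j ≤ K} min(SIZE_j, 2·RATE_j)`.**  Inputs, for ONE term at
cutoff `K` whose 𝐑-pieces `rfac` have creation scales `≤ K` (R-sc): the two-run 𝐑-rate `URateUpTo K RA RB …` with constant
`C_R` (binder (R-T), node U3's output for the 𝐑-functionals, NOT PRINTED), multiplicity of the 𝐑-pieces (M-R), a REFERENCE
WITNESS `v₁ ∈ Adm` with `U^A(v₁) = U₁^A`, `U^B(v₁) = U₁^B` (binder (F′) of the lineage — the same witness as the E-group's),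
and the two runs' one-run slice sizes (R-S) `|Σ_{scale X = j}(𝐑^A(X; g^A, U^A(v)) − 𝐑^A(X; g^A, U₁^A))| ≤ vol·(R₁·g^A_j^{κ₀})`,
likewise for run B.  Per slice: within `S_j = vol·R₁·(g^A_j^{κ₀} + g^B_j^{κ₀})` of zero (`rSlice_abs_le_size`) and within
`ρ_j = Cw·vol·(C_R θ^j Λ^{K−j})` of the rate centre (`T4TermwiseBudget.rateSlice_of_uRateUpTo` VERBATIM), the rate centre
itself within `ρ_j` of zero (`T4TermwiseDeviation.rateCentre_abs_le_of_witness` VERBATIM) — so within `min(S_j, 2ρ_j)` of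
zero; summed by `abs_sum_le_sum_min_of_slices`.  The centre of the 𝐑-kind IS zero: no (R′)-share. [folklore] -/
theorem rGroup_logRatio_le {RA : Functional C C.BgA} {RB : Functional C C.BgB} {gA gB : ℕ → ℝ} {uA : V → C.BgA}
    {uB : V → C.BgB} {Adm : Set V} {oneA : C.BgA} {oneB : C.BgB} {rfac : Finset C.Dom}
    {CrR θ κ Cw vol Λ R₁ : ℝ} {gsA gsB : ℕ → ℝ} {κ₀ K : ℕ} {v₁ : V}
    (hURR : URateUpTo K RA RB gA gB uA uB Adm CrR θ κ) (hCrR : 0 ≤ CrR) (hθ : 0 ≤ θ)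
    (hrsc : ∀ X ∈ rfac, C.scale X ≤ K)
    (hMR : Multiplicity rfac C.scale (fun X => Real.exp (-(κ * C.d X))) Cw vol Λ K)
    (hv₁ : v₁ ∈ Adm) (hA1 : uA v₁ = oneA) (hB1 : uB v₁ = oneB)
    (hRSA : ∀ v ∈ Adm, ∀ j ≤ K,
      |∑ X ∈ rfac with C.scale X = j, (RA gA (uA v) X - RA gA oneA X)| ≤ vol * (R₁ * gsA j ^ κ₀))
    (hRSB : ∀ v ∈ Adm, ∀ j ≤ K,
      |∑ X ∈ rfac with C.scale X = j, (RB gB (uB v) X - RB gB oneB X)| ≤ vol * (R₁ * gsB j ^ κ₀))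
    {v : V} (hv : v ∈ Adm) :
    |Real.log (∏ X ∈ rfac, Real.exp (RB gB (uB v) X - RB gB oneB X))
        - Real.log (∏ X ∈ rfac, Real.exp (RA gA (uA v) X - RA gA oneA X)) - 0|
      ≤ ∑ j ∈ range (K + 1),
          min (vol * (R₁ * gsA j ^ κ₀) + vol * (R₁ * gsB j ^ κ₀)) (2 * (Cw * vol * (CrR * θ ^ j * Λ ^ (K - j)))) := by
  rw [sub_zero, Real.log_prod (s := rfac) (fun _ _ => (Real.exp_pos _).ne'),
    Real.log_prod (s := rfac) (fun _ _ => (Real.exp_pos _).ne'), ← sum_sub_distrib]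
  refine abs_sum_le_sum_min_of_slices hrsc (fun j hj => rSlice_abs_le_size (hRSA v hv j hj) (hRSB v hv j hj))
    (fun j hj => ?_)
  -- the rate radius about the rate centre, and the rate centre about zero (witness)
  have hρ := rateSlice_of_uRateUpTo hURR oneA oneB hrsc hMR hCrR hθ hv hj
  have hκ := rateCentre_abs_le_of_witness (fac := rfac) hv₁ hA1 hB1 hURR hrsc hMR hCrR hθ j hj
  have h := abs_sub_abs_le_abs_sub
    (∑ X ∈ rfac with C.scale X = j,
      (Real.log (Real.exp (RB gB (uB v) X - RB gB oneB X)) - Real.log (Real.exp (RA gA (uA v) X - RA gA oneA X))))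
    (∑ X ∈ rfac with C.scale X = j, (-(RB gB oneB X - RA gA oneA X)))
  linarith

/-- `min` against a sum of nonnegative sizes: `min(a + b, c) ≤ min(a, c) + min(b, c)` for `a, b, c ≥ 0`. [folklore] -/
theorem min_add_le_add_min {a b c : ℝ} (ha : 0 ≤ a) (hb : 0 ≤ b) (hc : 0 ≤ c) :
    min (a + b) c ≤ min a c + min b c := by
  rcases le_total a c with hac | hca
  · rcases le_total b c with hbc | hcb
    · rw [min_eq_left hac, min_eq_left hbc]; exact min_le_left _ _
    · rw [min_eq_left hac, min_eq_right hcb]; exact (min_le_right _ _).trans (by linarith)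
  · rw [min_eq_right hca]; exact (min_le_right _ _).trans (by linarith [le_min hb hc, min_le_left b c])

/-- **THE 𝐑-RADIUS PER UNIT VOLUME.**  With `vol ≥ 0`, `R₁ ≥ 0`, nonnegative couplings, `C_R, θ, Λ ≥ 0`:
`Σ_{j ≤ K} min(vol·R₁(g^A_j^{κ₀} + g^B_j^{κ₀}), 2·Cw·vol·C_R θ^j Λ^{K−j}) ≤ vol·rρ_K`,
`rρ_K = max(2Cw,1)·(Σ_{j+n=K} min(R₁ g^A_j^{κ₀}, C_R θ^jΛⁿ) + Σ_{j+n=K} min(R₁ g^B_j^{κ₀}, C_R θ^jΛⁿ))` — TWO copies of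
the R-branch of `T4Crossover.crossoverDelta`, one per run's coupling table (`T4GoodClassBudget.sum_min_le_crossoverShape`
BY NAME, then `min_add_le_add_min`). [folklore] -/
theorem rRadius_le {Cw vol CrR θ Λ R₁ : ℝ} {gsA gsB : ℕ → ℝ} {κ₀ K : ℕ} (hvol : 0 ≤ vol) (hR₁ : 0 ≤ R₁)
    (hgsA : ∀ j ≤ K, 0 ≤ gsA j) (hgsB : ∀ j ≤ K, 0 ≤ gsB j) (hCrR : 0 ≤ CrR) (hθ : 0 ≤ θ) (hΛ : 0 ≤ Λ) :
    ∑ j ∈ range (K + 1), min (vol * (R₁ * gsA j ^ κ₀) + vol * (R₁ * gsB j ^ κ₀)) (2 * (Cw * vol * (CrR * θ ^ j * Λ ^ (K - j))))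
      ≤ vol * (max (2 * Cw) 1 * ((∑ p ∈ antidiagonal K, min (R₁ * gsA p.1 ^ κ₀) (CrR * θ ^ p.1 * Λ ^ p.2))
          + ∑ p ∈ antidiagonal K, min (R₁ * gsB p.1 ^ κ₀) (CrR * θ ^ p.1 * Λ ^ p.2))) := by
  set Cv := vol * max (2 * Cw) 1 with hCv
  have hCv0 : 0 ≤ Cv := mul_nonneg hvol (zero_le_one.trans (le_max_right _ _))
  have h1v : vol ≤ Cv :=
    calc vol = vol * 1 := (mul_one _).symm
      _ ≤ Cv := mul_le_mul_of_nonneg_left (le_max_right _ _) hvol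
  have h2v : 2 * (Cw * vol) ≤ Cv := by
    rw [hCv, show 2 * (Cw * vol) = vol * (2 * Cw) by ring]
    exact mul_le_mul_of_nonneg_left (le_max_left _ _) hvol
  -- the minimum form with the common factor `Cv` and size `SZ_j = R₁(g^A_j^{κ₀} + g^B_j^{κ₀})`
  have hS : ∀ j ≤ K, vol * (R₁ * gsA j ^ κ₀) + vol * (R₁ * gsB j ^ κ₀) ≤ Cv * (R₁ * gsA j ^ κ₀ + R₁ * gsB j ^ κ₀) :=
    fun j hj => by
      rw [← mul_add]
      exact mul_le_mul_of_nonneg_right h1v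
        (add_nonneg (mul_nonneg hR₁ (pow_nonneg (hgsA j hj) _)) (mul_nonneg hR₁ (pow_nonneg (hgsB j hj) _)))
  have hρ : ∀ j ≤ K, 2 * (Cw * vol * (CrR * θ ^ j * Λ ^ (K - j))) ≤ Cv * (CrR * θ ^ j * Λ ^ (K - j)) := fun j _ => by
    rw [show 2 * (Cw * vol * (CrR * θ ^ j * Λ ^ (K - j))) = 2 * (Cw * vol) * (CrR * θ ^ j * Λ ^ (K - j)) by ring]
    exact mul_le_mul_of_nonneg_right h2v (mul_nonneg (mul_nonneg hCrR (pow_nonneg hθ _)) (pow_nonneg hΛ _))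
  have hmin := sum_min_le_crossoverShape (SZ := fun j => R₁ * gsA j ^ κ₀ + R₁ * gsB j ^ κ₀) hS hρ
  refine hmin.trans ?_
  rw [hCv, mul_assoc, ← sum_add_distrib]
  refine mul_le_mul_of_nonneg_left (mul_le_mul_of_nonneg_left (sum_le_sum fun p hp => ?_)
    (zero_le_one.trans (le_max_right _ _))) hvol
  have hj : p.1 ≤ K := by have := mem_antidiagonal.mp hp; omega
  exact min_add_le_add_min (mul_nonneg hR₁ (pow_nonneg (hgsA p.1 hj) _)) (mul_nonneg hR₁ (pow_nonneg (hgsB p.1 hj) _))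
    (mul_nonneg (mul_nonneg hCrR (pow_nonneg hθ _)) (pow_nonneg hΛ _))

end RKind

/-! ## §2 `Σ_K rρ_K < ∞` from the flow window (0.31) in both runs and `κ₀ > 4` -/

/-- **THE 𝐑-RADIUS IS SUMMABLE (K-uniform rate constant).**  Under the flow window (0.31) p. 259 of [Balaban1987RG1] at
every cutoff for BOTH runs' coupling tables (`Step.Discrete031`, the cell's BetaPertH-road conditional, BY NAME; only its
LOWER half `1/g² + b(K−j) ≤ 1/g_{K,j}²` is used), nonnegative couplings, `R₁, C_R ≥ 0`, a rate `0 < θ < 1` with `θ ≤ Λ` and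
`κ₀ > 4` ((2.31) p. 260: «κ₀ can be chosen arbitrarily large»; (2.46) p. 263: «for κ₀ ≧ 7»): `Σ_K rρ_K < ∞` —
`T4Crossover.exists_recentRate_lt_one` + `T4Crossover.summable_sum_min_coupling` (recent slices by the rate, old slices by
`g_{K,j}^{κ₀} ≤ (bσ(K+1))^{−κ₀/2}`), once per run. [folklore] -/
theorem summable_rRadius {b β' R₁ CrR θ Λ Cw : ℝ} {gfA gfB : ℕ → ℝ} {gsA gsB : ℕ → ℕ → ℝ} {κ₀ : ℕ} (hb : 0 < b)
    (h031A : ∀ K, Step.Discrete031 b β' K (gfA K) (gsA K)) (h031B : ∀ K, Step.Discrete031 b β' K (gfB K) (gsB K))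
    (hgsA : ∀ K k, k ≤ K → 0 ≤ gsA K k) (hgsB : ∀ K k, k ≤ K → 0 ≤ gsB K k) (hR₁ : 0 ≤ R₁) (hCrR : 0 ≤ CrR)
    (hθ : 0 < θ) (hθ1 : θ < 1) (hθΛ : θ ≤ Λ) (hκ₀ : 4 < κ₀) :
    Summable (fun K => max (2 * Cw) 1 * ((∑ p ∈ antidiagonal K, min (R₁ * gsA K p.1 ^ κ₀) (CrR * θ ^ p.1 * Λ ^ p.2))
      + ∑ p ∈ antidiagonal K, min (R₁ * gsB K p.1 ^ κ₀) (CrR * θ ^ p.1 * Λ ^ p.2))) := by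
  obtain ⟨σ, hσ, hq⟩ := exists_recentRate_lt_one hθ hθ1 hθΛ
  exact ((summable_sum_min_coupling hb h031A hgsA hR₁ hCrR hθ hθΛ hσ hq hκ₀).add
    (summable_sum_min_coupling hb h031B hgsB hR₁ hCrR hθ hθΛ hσ hq hκ₀)).mul_left _

/-- The same with a POLYNOMIALLY GROWING rate constant `C_R·(K+1)^p` (generation 1's
`T4TowerRateComposition.summable_sum_min_coupling_poly`: the polynomial only multiplies the geometric recent part; `κ₀ > 4`
unchanged) — for an 𝐑-rate family whose constant is not `K`-uniform (a merely polynomial NE3 for the 𝐑-functionals).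
[folklore] -/
theorem summable_rRadius_poly {b β' R₁ CrR θ Λ Cw : ℝ} {gfA gfB : ℕ → ℝ} {gsA gsB : ℕ → ℕ → ℝ} {κ₀ p : ℕ}
    (hb : 0 < b) (h031A : ∀ K, Step.Discrete031 b β' K (gfA K) (gsA K))
    (h031B : ∀ K, Step.Discrete031 b β' K (gfB K) (gsB K)) (hgsA : ∀ K k, k ≤ K → 0 ≤ gsA K k)
    (hgsB : ∀ K k, k ≤ K → 0 ≤ gsB K k) (hR₁ : 0 ≤ R₁) (hCrR : 0 ≤ CrR) (hθ : 0 < θ) (hθ1 : θ < 1) (hθΛ : θ ≤ Λ)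
    (hκ₀ : 4 < κ₀) :
    Summable (fun K => max (2 * Cw) 1 *
      ((∑ x ∈ antidiagonal K, min (R₁ * gsA K x.1 ^ κ₀) (CrR * ((K : ℝ) + 1) ^ p * θ ^ x.1 * Λ ^ x.2))
        + ∑ x ∈ antidiagonal K, min (R₁ * gsB K x.1 ^ κ₀) (CrR * ((K : ℝ) + 1) ^ p * θ ^ x.1 * Λ ^ x.2))) := by
  obtain ⟨σ, hσ, hq⟩ := exists_recentRate_lt_one hθ hθ1 hθΛ
  exact ((summable_sum_min_coupling_poly hb h031A hgsA hR₁ hCrR hθ hθΛ hσ hq hκ₀ (p := p)).add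
    (summable_sum_min_coupling_poly hb h031B hgsB hR₁ hCrR hθ hθΛ hσ hq hκ₀ (p := p))).mul_left _

/-! ## §3 The residual split `r = ρ·r′` (pure algebra) -/

/-- **THE RESIDUAL SPLIT AT ONE DATUM.**  Residual factors `r^A = ρ^A·r′^A`, `r^B = ρ^B·r′^B`, all positive, with the
𝐑-groups `ρ` within `Rρ` OF ZERO (§1) and the residual-proper pair within `R′` of a centre `c`: the products are positive and
`|log r^B − log r^A − c| ≤ Rρ + R′` — the centre of the residual IS the residual-proper centre; radii add. [folklore] -/
theorem residual_split_pointwise {ρA ρB rA rB c Rρ RR : ℝ} (hρA : 0 < ρA) (hρB : 0 < ρB) (hrA : 0 < rA) (hrB : 0 < rB)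
    (hρ : |Real.log ρB - Real.log ρA - 0| ≤ Rρ) (hR : |Real.log rB - Real.log rA - c| ≤ RR) :
    0 < ρA * rA ∧ 0 < ρB * rB ∧ |Real.log (ρB * rB) - Real.log (ρA * rA) - c| ≤ Rρ + RR := by
  refine ⟨mul_pos hρA hrA, mul_pos hρB hrB, ?_⟩
  have e : Real.log (ρB * rB) - Real.log (ρA * rA) - c
      = (Real.log ρB - Real.log ρA - 0) + (Real.log rB - Real.log rA - c) := by
    rw [Real.log_mul hρB.ne' hrB.ne', Real.log_mul hρA.ne' hrA.ne']; ring
  rw [e]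
  exact (abs_add_le _ _).trans (add_le_add hρ hR)


/-! ## §4 The route's per-family capstone RE-KEYED: (R)+(R′) asked of the residual-proper kind only -/

section Ledger

variable {C : T4BoundaryCarrier.Carriers} {ι : Type} [MeasurableSpace ι] {σ : Type*} [DecidableEq σ] {l₀ vol : ℝ}
  {T : ℕ → Finset σ} {Bad : ℕ → ℝ → Finset σ} {A B : ℕ → ℝ → σ → ℝ} {μ : ℕ → ℝ → σ → Measure ι}
  {fac bfac rfac : ℕ → ℝ → σ → Finset C.Dom} {Adm : Set ι} {EA : Functional C.toCarriers C.BgA}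
  {EB : Functional C.toCarriers C.BgB} {BA : BFunctional C C.BgA} {BB : BFunctional C C.BgB}
  {RA : Functional C.toCarriers C.BgA} {RB : Functional C.toCarriers C.BgB}
  {κ θ' Cr EB₀ CrR R₁ b β' : ℝ} {κ₀ : ℕ} {gA gB : ℕ → ℕ → ℝ} {gfA gfB : ℕ → ℝ} {gsA gsB : ℕ → ℕ → ℝ}
  {uA : ℕ → ι → C.BgA} {uB : ℕ → ι → C.BgB} {oneA : C.BgA} {oneB : C.BgB}
  {pend : ℕ → ℝ → σ → ι → C.Fl} {nA nB rA rB : ℕ → ℝ → σ → ι → ℝ} {qA qB : ℕ → ℝ}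
  {κ₁ S : ℕ → ℝ → σ → ℕ → ℝ} {cR RR : ℕ → ℝ → σ → ℝ} {rR zA zB Wb c₀ s : ℕ → ℝ} {Cw E a Λ Cl : ℝ}

/-- **THE GOOD-CLASS HALF WITH `Summable δ″`, THE 𝐑-KIND RESOLVED.**  As generation 6's
`T4TermwiseBoundary.goodClause_summable_of_kinds_witness` (composed E-rate `hUR`, boundary rate family `hURB`, format (F),
sizes (S), multiplicities (M)(M-B), witness (F′), (B-adm)(B-win), one-sided sizes (N), constants (Q)), with the residual
factors of the format SPLIT as `(∏_{X∈rfac} e^{RA(gA K, U^A_K v, X) − RA(gA K, U₁^A, X)})·r′^A`, likewise for run B — the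
𝐑-GROUP of (2.30)-shaped factors (LOCATION p. 260) times the RESIDUAL-PROPER factor — and generation 6's (R)(R′) REPLACED
by: (R-T) the 𝐑-rate family `hURR` (NOT PRINTED: node U3's output for the 𝐑-functionals; §5 produces it from node-U3-type
shapes); (R-sc) creation scales of the 𝐑-pieces `≤ K` and (M-R) their multiplicity; (R-S) the two runs' one-run slice
sizes `vol·R₁·g^A_{K,j}^{κ₀}`, `vol·R₁·g^B_{K,j}^{κ₀}` (all-regular part of (2.44) p. 263, one run at a time — LOCATED, a
hypothesis); (0.31) the flow window at every cutoff for both coupling tables (`Step.Discrete031`, BetaPertH road BY NAME),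
`0 < b`, nonnegative couplings, `0 ≤ R₁`, `4 < κ₀`; and (R-res′)(R′-res′) radii `RR ≤ vol·rR`, `Σ rR < ∞` and centring
`|cR − c₀| ≤ vol·s`, `Σ s < ∞` FOR THE RESIDUAL-PROPER KIND ONLY — what is left of hazard H-U5b-1 after this leaf (NOT
PRINTED).  OUTPUT: the good clause with the explicit `δ″` below (generation 6's `δ′` with `rR_K ↦ rρ_K + rR_K`) and
`Summable δ″`. [folklore] -/
theorem goodClause_summable_of_kindsR_witness
    (hUR : ∀ K, URateUpTo K EA EB (gA K) (gB K) (uA K) (uB K) Adm Cr θ' κ) (hCr : 0 ≤ Cr)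
    (hθ'0 : 0 < θ') (hθ'1 : θ' < 1) (hθ'Λ : θ' ≤ Λ) (hΛ1 : 1 ≤ Λ) (hCl : 0 ≤ Cl)
    (hURB : ∀ b ∈ C.admFl, ∀ K, URateUpTo K (atFl BA b) (atFl BB b) (gA K) (gB K) (uA K) (uB K) Adm EB₀ θ' κ)
    (hEB₀ : 0 ≤ EB₀)
    (hURR : ∀ K, URateUpTo K RA RB (gA K) (gB K) (uA K) (uB K) Adm CrR θ' κ) (hCrR : 0 ≤ CrR)
    (hfmtA : ∀ K t τ, A K t τ = ∫ v, (∏ X ∈ fac K t τ,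
      Real.exp (EA (gA K) (uA K v) X - EA (gA K) oneA X)) *
        ((∏ X ∈ bfac K t τ, Real.exp (BA (gA K) (uA K v) (pend K t τ v) X)) * nA K t τ v * qA K *
          ((∏ X ∈ rfac K t τ, Real.exp (RA (gA K) (uA K v) X - RA (gA K) oneA X)) * rA K t τ v))
          ∂(μ K t τ))
    (hfmtB : ∀ K t τ, B K t τ = ∫ v, (∏ X ∈ fac K t τ,
      Real.exp (EB (gB K) (uB K v) X - EB (gB K) oneB X)) *
        ((∏ X ∈ bfac K t τ, Real.exp (BB (gB K) (uB K v) (pend K t τ v) X)) * nB K t τ v * qB K *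
          ((∏ X ∈ rfac K t τ, Real.exp (RB (gB K) (uB K v) X - RB (gB K) oneB X)) * rB K t τ v))
          ∂(μ K t τ))
    (hint : ∀ K t, |t| ≤ l₀ → ∀ τ ∈ T K \ Bad K t,
      Integrable (fun v => (∏ X ∈ fac K t τ, Real.exp (EA (gA K) (uA K v) X - EA (gA K) oneA X)) *
        ((∏ X ∈ bfac K t τ, Real.exp (BA (gA K) (uA K v) (pend K t τ v) X)) * nA K t τ v * qA K *
          ((∏ X ∈ rfac K t τ, Real.exp (RA (gA K) (uA K v) X - RA (gA K) oneA X)) * rA K t τ v)))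
          (μ K t τ) ∧
      Integrable (fun v => (∏ X ∈ fac K t τ, Real.exp (EB (gB K) (uB K v) X - EB (gB K) oneB X)) *
        ((∏ X ∈ bfac K t τ, Real.exp (BB (gB K) (uB K v) (pend K t τ v) X)) * nB K t τ v * qB K *
          ((∏ X ∈ rfac K t τ, Real.exp (RB (gB K) (uB K v) X - RB (gB K) oneB X)) * rB K t τ v)))
          (μ K t τ))
    (hsc : ∀ K t, |t| ≤ l₀ → ∀ τ ∈ T K \ Bad K t, ∀ X ∈ fac K t τ, C.scale X ≤ K)
    (hoff : ∀ K t, |t| ≤ l₀ → ∀ τ ∈ T K \ Bad K t, ∀ v, v ∉ Adm →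
      (∏ X ∈ fac K t τ, Real.exp (EA (gA K) (uA K v) X - EA (gA K) oneA X)) *
        ((∏ X ∈ bfac K t τ, Real.exp (BA (gA K) (uA K v) (pend K t τ v) X)) * nA K t τ v * qA K *
          ((∏ X ∈ rfac K t τ, Real.exp (RA (gA K) (uA K v) X - RA (gA K) oneA X)) * rA K t τ v))
          = 0 ∧
      (∏ X ∈ fac K t τ, Real.exp (EB (gB K) (uB K v) X - EB (gB K) oneB X)) *
        ((∏ X ∈ bfac K t τ, Real.exp (BB (gB K) (uB K v) (pend K t τ v) X)) * nB K t τ v * qB K *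
          ((∏ X ∈ rfac K t τ, Real.exp (RB (gB K) (uB K v) X - RB (gB K) oneB X)) * rB K t τ v))
          = 0)
    (hS : ∀ K t, |t| ≤ l₀ → ∀ τ ∈ T K \ Bad K t, ∀ v ∈ Adm, ∀ j ≤ K,
      |(∑ X ∈ fac K t τ with C.scale X = j,
          (Real.log (Real.exp (EB (gB K) (uB K v) X - EB (gB K) oneB X))
            - Real.log (Real.exp (EA (gA K) (uA K v) X - EA (gA K) oneA X)))) - κ₁ K t τ j| ≤ S K t τ j)
    (hM : ∀ K t, |t| ≤ l₀ → ∀ τ ∈ T K \ Bad K t,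
      Multiplicity (fac K t τ) C.scale (fun X => Real.exp (-(κ * C.d X))) Cw vol Λ K)
    (hwit : ∀ K, ∃ v₁ ∈ Adm, uA K v₁ = oneA ∧ uB K v₁ = oneB)
    (hvol : 0 ≤ vol) (hE : 0 ≤ E) (ha0 : 0 < a) (ha1 : a < 1)
    (hSle : ∀ K t, |t| ≤ l₀ → ∀ τ ∈ T K \ Bad K t, ∀ j ≤ K, S K t τ j ≤ vol * (E * a ^ (K - j)))
    (hpend : ∀ K t, |t| ≤ l₀ → ∀ τ ∈ T K \ Bad K t, ∀ v ∈ Adm, pend K t τ v ∈ C.admFl)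
    (hBwin : ∀ K t, |t| ≤ l₀ → ∀ τ ∈ T K \ Bad K t, RecentOnly (bfac K t τ) C.scale (jlogOf Cl K) K)
    (hMB : ∀ K t, |t| ≤ l₀ → ∀ τ ∈ T K \ Bad K t,
      Multiplicity (bfac K t τ) C.scale (fun X => Real.exp (-(κ * C.d X))) Cw vol Λ K)
    (hnpos : ∀ K t, |t| ≤ l₀ → ∀ τ ∈ T K \ Bad K t, ∀ v ∈ Adm, 0 < nA K t τ v ∧ 0 < nB K t τ v)
    (hzA : ∀ K t, |t| ≤ l₀ → ∀ τ ∈ T K \ Bad K t, ∀ v ∈ Adm, |Real.log (nA K t τ v)| ≤ vol * zA K)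
    (hzB : ∀ K t, |t| ≤ l₀ → ∀ τ ∈ T K \ Bad K t, ∀ v ∈ Adm, |Real.log (nB K t τ v)| ≤ vol * zB K)
    (hzAs : Summable zA) (hzBs : Summable zB)
    (hq : ∀ K, 0 < qA K ∧ 0 < qB K)
    -- the 𝐑-kind: scales, multiplicity, one-run slice sizes, the flow window of both coupling tables
    (hrsc : ∀ K t, |t| ≤ l₀ → ∀ τ ∈ T K \ Bad K t, ∀ X ∈ rfac K t τ, C.scale X ≤ K)
    (hMR : ∀ K t, |t| ≤ l₀ → ∀ τ ∈ T K \ Bad K t,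
      Multiplicity (rfac K t τ) C.scale (fun X => Real.exp (-(κ * C.d X))) Cw vol Λ K)
    (hRSA : ∀ K t, |t| ≤ l₀ → ∀ τ ∈ T K \ Bad K t, ∀ v ∈ Adm, ∀ j ≤ K,
      |∑ X ∈ rfac K t τ with C.scale X = j, (RA (gA K) (uA K v) X - RA (gA K) oneA X)| ≤ vol * (R₁ * gsA K j ^ κ₀))
    (hRSB : ∀ K t, |t| ≤ l₀ → ∀ τ ∈ T K \ Bad K t, ∀ v ∈ Adm, ∀ j ≤ K,
      |∑ X ∈ rfac K t τ with C.scale X = j, (RB (gB K) (uB K v) X - RB (gB K) oneB X)| ≤ vol * (R₁ * gsB K j ^ κ₀))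
    (hb : 0 < b) (h031A : ∀ K, Step.Discrete031 b β' K (gfA K) (gsA K))
    (h031B : ∀ K, Step.Discrete031 b β' K (gfB K) (gsB K)) (hgsA : ∀ K k, k ≤ K → 0 ≤ gsA K k)
    (hgsB : ∀ K k, k ≤ K → 0 ≤ gsB K k) (hR₁ : 0 ≤ R₁) (hκ₀ : 4 < κ₀)
    -- the residual-proper kind: (R-res′), (R′-res′)
    (hrpos : ∀ K t, |t| ≤ l₀ → ∀ τ ∈ T K \ Bad K t, ∀ v ∈ Adm, 0 < rA K t τ v ∧ 0 < rB K t τ v)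
    (hR : ∀ K t, |t| ≤ l₀ → ∀ τ ∈ T K \ Bad K t, ∀ v ∈ Adm,
      |Real.log (rB K t τ v) - Real.log (rA K t τ v) - cR K t τ| ≤ RR K t τ)
    (hRR : ∀ K t, |t| ≤ l₀ → ∀ τ ∈ T K \ Bad K t, RR K t τ ≤ vol * rR K) (hrR : Summable rR)
    (hs : Summable s) (hR' : ∀ K t, |t| ≤ l₀ → ∀ τ ∈ T K \ Bad K t, |cR K t τ - c₀ K| ≤ vol * s K) :
    GoodClause l₀ vol T A B Bad
        (fun K => (max Cw 1 * ((E + Cr) * ∑ x ∈ antidiagonal K, min (a ^ x.2) (θ' ^ x.1 * Λ ^ x.2))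
            + (EB₀ * Cw * windowSum θ' Λ (jlogOf Cl K) K + (zA K + zB K)
              + (max (2 * Cw) 1 * ((∑ p ∈ antidiagonal K, min (R₁ * gsA K p.1 ^ κ₀) (CrR * θ' ^ p.1 * Λ ^ p.2))
                  + ∑ p ∈ antidiagonal K, min (R₁ * gsB K p.1 ^ κ₀) (CrR * θ' ^ p.1 * Λ ^ p.2)) + rR K)))
          + (max Cw 1 * ((E + Cr) * ∑ x ∈ antidiagonal K, min (a ^ x.2) (θ' ^ x.1 * Λ ^ x.2)) + s K)) ∧
      Summable (fun K => (max Cw 1 * ((E + Cr) * ∑ x ∈ antidiagonal K, min (a ^ x.2) (θ' ^ x.1 * Λ ^ x.2))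
            + (EB₀ * Cw * windowSum θ' Λ (jlogOf Cl K) K + (zA K + zB K)
              + (max (2 * Cw) 1 * ((∑ p ∈ antidiagonal K, min (R₁ * gsA K p.1 ^ κ₀) (CrR * θ' ^ p.1 * Λ ^ p.2))
                  + ∑ p ∈ antidiagonal K, min (R₁ * gsB K p.1 ^ κ₀) (CrR * θ' ^ p.1 * Λ ^ p.2)) + rR K)))
          + (max Cw 1 * ((E + Cr) * ∑ x ∈ antidiagonal K, min (a ^ x.2) (θ' ^ x.1 * Λ ^ x.2)) + s K)) := by
  -- the residual split at every good term and admissible datum (§1 𝐑-group + §3 algebra)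
  have hsplit : ∀ K t, |t| ≤ l₀ → ∀ τ ∈ T K \ Bad K t, ∀ v ∈ Adm,
      0 < (∏ X ∈ rfac K t τ, Real.exp (RA (gA K) (uA K v) X - RA (gA K) oneA X)) * rA K t τ v ∧
      0 < (∏ X ∈ rfac K t τ, Real.exp (RB (gB K) (uB K v) X - RB (gB K) oneB X)) * rB K t τ v ∧
      |Real.log ((∏ X ∈ rfac K t τ, Real.exp (RB (gB K) (uB K v) X - RB (gB K) oneB X)) * rB K t τ v)
          - Real.log ((∏ X ∈ rfac K t τ, Real.exp (RA (gA K) (uA K v) X - RA (gA K) oneA X)) * rA K t τ v)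
          - cR K t τ|
        ≤ vol * (max (2 * Cw) 1 * ((∑ p ∈ antidiagonal K, min (R₁ * gsA K p.1 ^ κ₀) (CrR * θ' ^ p.1 * Λ ^ p.2))
            + ∑ p ∈ antidiagonal K, min (R₁ * gsB K p.1 ^ κ₀) (CrR * θ' ^ p.1 * Λ ^ p.2))) + RR K t τ := by
    intro K t ht τ hτ v hv
    obtain ⟨v₁, hv₁, hA1, hB1⟩ := hwit K
    have hρ := (rGroup_logRatio_le (C := C.toCarriers) (hURR K) hCrR hθ'0.le (hrsc K t ht τ hτ) (hMR K t ht τ hτ) hv₁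
      hA1 hB1 (hRSA K t ht τ hτ) (hRSB K t ht τ hτ) hv).trans
      (rRadius_le hvol hR₁ (hgsA K) (hgsB K) hCrR hθ'0.le (zero_le_one.trans hΛ1))
    exact residual_split_pointwise (rGroup_pos (C := C.toCarriers) RA (gA K) (uA K v) oneA (rfac K t τ))
      (rGroup_pos (C := C.toCarriers) RB (gB K) (uB K v) oneB (rfac K t τ)) (hrpos K t ht τ hτ v hv).1
      (hrpos K t ht τ hτ v hv).2 hρ (hR K t ht τ hτ v hv)
  have hrρ := summable_rRadius (Cw := Cw) hb h031A h031B hgsA hgsB hR₁ hCrR hθ'0 hθ'1 hθ'Λ hκ₀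
  exact goodClause_summable_of_kinds_witness
    (rA := fun K t τ v => (∏ X ∈ rfac K t τ, Real.exp (RA (gA K) (uA K v) X - RA (gA K) oneA X)) * rA K t τ v)
    (rB := fun K t τ v => (∏ X ∈ rfac K t τ, Real.exp (RB (gB K) (uB K v) X - RB (gB K) oneB X)) * rB K t τ v)
    (RR := fun K t τ => vol * (max (2 * Cw) 1 * ((∑ p ∈ antidiagonal K, min (R₁ * gsA K p.1 ^ κ₀)
        (CrR * θ' ^ p.1 * Λ ^ p.2)) + ∑ p ∈ antidiagonal K, min (R₁ * gsB K p.1 ^ κ₀) (CrR * θ' ^ p.1 * Λ ^ p.2)))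
      + RR K t τ)
    (rR := fun K => max (2 * Cw) 1 * ((∑ p ∈ antidiagonal K, min (R₁ * gsA K p.1 ^ κ₀) (CrR * θ' ^ p.1 * Λ ^ p.2))
        + ∑ p ∈ antidiagonal K, min (R₁ * gsB K p.1 ^ κ₀) (CrR * θ' ^ p.1 * Λ ^ p.2)) + rR K)
    hUR hCr hθ'0 hθ'1 hθ'Λ hΛ1 hCl hURB hEB₀ hfmtA hfmtB hint hsc hoff hS hM hwit hvol hE ha0 ha1 hSle hpend hBwin hMB
    hnpos hzA hzB hzAs hzBs hq (fun K t ht τ hτ v hv => ⟨(hsplit K t ht τ hτ v hv).1, (hsplit K t ht τ hτ v hv).2.1⟩)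
    (fun K t ht τ hτ v hv => (hsplit K t ht τ hτ v hv).2.2)
    (fun K t ht τ hτ => by
      have h1 := hRR K t ht τ hτ
      rw [mul_add]; linarith)
    (hrρ.add hrR) hs hR'

end Ledger


/-! ## §5 All strings of a scheme: the node-U0 targets with the 𝐑-kind resolved -/

section Scheme

open Missing T4Continuum T4Assembly
open T4EtaRateMin (Readings LocalRate)
open T4RateLiaison (GaugeDominated)

variable {G : Type*} [GaugeGroup G] [MeasurableSpace G] [HaarData G] {O : Type*}

variable {C : T4BoundaryCarrier.Carriers} {ι X : Type} [MeasurableSpace ι] {Adm : Set ι}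
  {EA : Functional C.toCarriers C.BgA} {EB : Functional C.toCarriers C.BgB} {BA : BFunctional C C.BgA}
  {BB : BFunctional C C.BgB} {RA : Functional C.toCarriers C.BgA} {RB : Functional C.toCarriers C.BgB}
  {κ θ' Cr EB₀ CrR R₁ b β' : ℝ} {κ₀ : ℕ} {gA gB : ℕ → ℕ → ℝ} {gfA gfB : ℕ → ℝ} {gsA gsB : ℕ → ℕ → ℝ}
  {uA : ℕ → ι → C.BgA} {uB : ℕ → ι → C.BgB} {oneA : C.BgA} {oneB : C.BgB} {Cw E a Λ Cl : ℝ}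

/-- **ALL STRINGS, GIVEN THE THREE RATE FAMILIES — the term-wise route's capstone with the 𝐑-kind resolved.**  As
generation 6's `T4TermwiseBoundary.hasContinuumLimit_of_kinds_rate_witness` (string-independent composed E-rate `hUR` and
boundary rate family `hURB`, witness (F′), per-string (F)(S)(M)(M-B)(B-adm)(B-win)(N)(Q)(W)(L1-pos)(E1/E2)), with the
string-independent 𝐑-RATE FAMILY `hURR` (NOT PRINTED), per string the 𝐑-pieces' scales and multiplicity (R-sc)(M-R) and
one-run slice sizes (R-S), the flow window (0.31) of both coupling tables at every cutoff (BetaPertH road BY NAME) with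
`4 < κ₀`, and (R-res′)(R′-res′) radii and centring FOR THE RESIDUAL-PROPER KIND ONLY.  CONCLUSION: node U0's three
targets.  HONEST FRAMING: fixed finite torus, rung (B)+1, CONDITIONAL on every binder named — NE7 (both halves) NOT PRINTED;
nothing here is infinite volume, a mass gap, or the Clay problem. [folklore] -/
theorem hasContinuumLimit_of_kindsR_rate_witness [RegularGaugeGroup G] {σ : List O → Type} [∀ os, DecidableEq (σ os)]
    {l₀ : ℝ} {vol : List O → ℝ} {K₀ : List O → ℕ} {T : (os : List O) → ℕ → Finset (σ os)}
    {Bad : (os : List O) → ℕ → ℝ → Finset (σ os)} {A B : (os : List O) → ℕ → ℝ → σ os → ℝ}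
    {μ : (os : List O) → ℕ → ℝ → σ os → Measure ι} {fac bfac rfac : (os : List O) → ℕ → ℝ → σ os → Finset C.Dom}
    {pend : (os : List O) → ℕ → ℝ → σ os → ι → C.Fl} {nA nB rA rB : (os : List O) → ℕ → ℝ → σ os → ι → ℝ}
    {qA qB : List O → ℕ → ℝ} {κ₁ S : (os : List O) → ℕ → ℝ → σ os → ℕ → ℝ}
    {cR RR : (os : List O) → ℕ → ℝ → σ os → ℝ} {rR zA zB Wb : List O → ℕ → ℝ}
    (Sc : TorusScheme G O) (hβ : ∀ K, 0 ≤ Sc.β K) (hm : ∀ K o, Measurable (Sc.obs K o))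
    (h1 : ∀ K o U, |Sc.obs K o U| ≤ 1) (hl₀ : 0 < l₀)
    (hUR : ∀ K, URateUpTo K EA EB (gA K) (gB K) (uA K) (uB K) Adm Cr θ' κ) (hCr : 0 ≤ Cr)
    (hθ'0 : 0 < θ') (hθ'1 : θ' < 1) (hθ'Λ : θ' ≤ Λ) (hΛ1 : 1 ≤ Λ) (hCl : 0 ≤ Cl) (hE : 0 ≤ E) (ha0 : 0 < a)
    (ha1 : a < 1)
    (hURB : ∀ b ∈ C.admFl, ∀ K, URateUpTo K (atFl BA b) (atFl BB b) (gA K) (gB K) (uA K) (uB K) Adm EB₀ θ' κ)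
    (hEB₀ : 0 ≤ EB₀)
    (hURR : ∀ K, URateUpTo K RA RB (gA K) (gB K) (uA K) (uB K) Adm CrR θ' κ) (hCrR : 0 ≤ CrR)
    (hwit : ∀ K, ∃ v₁ ∈ Adm, uA K v₁ = oneA ∧ uB K v₁ = oneB)
    (hvol : ∀ os, 0 < vol os)
    (hfmtA : ∀ os K t τ, A os K t τ = ∫ v, (∏ X ∈ fac os K t τ,
      Real.exp (EA (gA K) (uA K v) X - EA (gA K) oneA X)) *
        ((∏ X ∈ bfac os K t τ, Real.exp (BA (gA K) (uA K v) (pend os K t τ v) X)) * nA os K t τ v * qA os K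
          * ((∏ X ∈ rfac os K t τ, Real.exp (RA (gA K) (uA K v) X - RA (gA K) oneA X)) * rA os K t τ v))
          ∂(μ os K t τ))
    (hfmtB : ∀ os K t τ, B os K t τ = ∫ v, (∏ X ∈ fac os K t τ,
      Real.exp (EB (gB K) (uB K v) X - EB (gB K) oneB X)) *
        ((∏ X ∈ bfac os K t τ, Real.exp (BB (gB K) (uB K v) (pend os K t τ v) X)) * nB os K t τ v * qB os K
          * ((∏ X ∈ rfac os K t τ, Real.exp (RB (gB K) (uB K v) X - RB (gB K) oneB X)) * rB os K t τ v))
          ∂(μ os K t τ))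
    (hint : ∀ os K t, |t| ≤ l₀ → ∀ τ ∈ T os K \ Bad os K t,
      Integrable (fun v => (∏ X ∈ fac os K t τ, Real.exp (EA (gA K) (uA K v) X - EA (gA K) oneA X)) *
        ((∏ X ∈ bfac os K t τ, Real.exp (BA (gA K) (uA K v) (pend os K t τ v) X)) * nA os K t τ v * qA os K
          * ((∏ X ∈ rfac os K t τ, Real.exp (RA (gA K) (uA K v) X - RA (gA K) oneA X)) * rA os K t τ v)))
          (μ os K t τ) ∧
      Integrable (fun v => (∏ X ∈ fac os K t τ, Real.exp (EB (gB K) (uB K v) X - EB (gB K) oneB X)) *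
        ((∏ X ∈ bfac os K t τ, Real.exp (BB (gB K) (uB K v) (pend os K t τ v) X)) * nB os K t τ v * qB os K
          * ((∏ X ∈ rfac os K t τ, Real.exp (RB (gB K) (uB K v) X - RB (gB K) oneB X)) * rB os K t τ v)))
          (μ os K t τ))
    (hsc : ∀ os K t, |t| ≤ l₀ → ∀ τ ∈ T os K \ Bad os K t, ∀ X ∈ fac os K t τ, C.scale X ≤ K)
    (hoff : ∀ os K t, |t| ≤ l₀ → ∀ τ ∈ T os K \ Bad os K t, ∀ v, v ∉ Adm →
      (∏ X ∈ fac os K t τ, Real.exp (EA (gA K) (uA K v) X - EA (gA K) oneA X)) *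
        ((∏ X ∈ bfac os K t τ, Real.exp (BA (gA K) (uA K v) (pend os K t τ v) X)) * nA os K t τ v * qA os K
          * ((∏ X ∈ rfac os K t τ, Real.exp (RA (gA K) (uA K v) X - RA (gA K) oneA X)) * rA os K t τ v)) = 0 ∧
      (∏ X ∈ fac os K t τ, Real.exp (EB (gB K) (uB K v) X - EB (gB K) oneB X)) *
        ((∏ X ∈ bfac os K t τ, Real.exp (BB (gB K) (uB K v) (pend os K t τ v) X)) * nB os K t τ v * qB os K
          * ((∏ X ∈ rfac os K t τ, Real.exp (RB (gB K) (uB K v) X - RB (gB K) oneB X)) * rB os K t τ v)) = 0)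
    (hS : ∀ os K t, |t| ≤ l₀ → ∀ τ ∈ T os K \ Bad os K t, ∀ v ∈ Adm, ∀ j ≤ K,
      |(∑ X ∈ fac os K t τ with C.scale X = j,
          (Real.log (Real.exp (EB (gB K) (uB K v) X - EB (gB K) oneB X))
            - Real.log (Real.exp (EA (gA K) (uA K v) X - EA (gA K) oneA X)))) - κ₁ os K t τ j| ≤ S os K t τ j)
    (hM : ∀ os K t, |t| ≤ l₀ → ∀ τ ∈ T os K \ Bad os K t,
      Multiplicity (fac os K t τ) C.scale (fun X => Real.exp (-(κ * C.d X))) Cw (vol os) Λ K)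
    (hSle : ∀ os K t, |t| ≤ l₀ → ∀ τ ∈ T os K \ Bad os K t, ∀ j ≤ K,
      S os K t τ j ≤ vol os * (E * a ^ (K - j)))
    (hpend : ∀ os K t, |t| ≤ l₀ → ∀ τ ∈ T os K \ Bad os K t, ∀ v ∈ Adm, pend os K t τ v ∈ C.admFl)
    (hBwin : ∀ os K t, |t| ≤ l₀ → ∀ τ ∈ T os K \ Bad os K t, RecentOnly (bfac os K t τ) C.scale (jlogOf Cl K) K)
    (hMB : ∀ os K t, |t| ≤ l₀ → ∀ τ ∈ T os K \ Bad os K t,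
      Multiplicity (bfac os K t τ) C.scale (fun X => Real.exp (-(κ * C.d X))) Cw (vol os) Λ K)
    (hnpos : ∀ os K t, |t| ≤ l₀ → ∀ τ ∈ T os K \ Bad os K t, ∀ v ∈ Adm, 0 < nA os K t τ v ∧ 0 < nB os K t τ v)
    (hzA : ∀ os K t, |t| ≤ l₀ → ∀ τ ∈ T os K \ Bad os K t, ∀ v ∈ Adm,
      |Real.log (nA os K t τ v)| ≤ vol os * zA os K)
    (hzB : ∀ os K t, |t| ≤ l₀ → ∀ τ ∈ T os K \ Bad os K t, ∀ v ∈ Adm,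
      |Real.log (nB os K t τ v)| ≤ vol os * zB os K)
    (hzAs : ∀ os, Summable (zA os)) (hzBs : ∀ os, Summable (zB os))
    (hq : ∀ os K, 0 < qA os K ∧ 0 < qB os K)
    -- the 𝐑-kind per string: scales, multiplicity, one-run slice sizes; the flow window of both coupling tables
    (hrsc : ∀ os K t, |t| ≤ l₀ → ∀ τ ∈ T os K \ Bad os K t, ∀ X ∈ rfac os K t τ, C.scale X ≤ K)
    (hMR : ∀ os K t, |t| ≤ l₀ → ∀ τ ∈ T os K \ Bad os K t,
      Multiplicity (rfac os K t τ) C.scale (fun X => Real.exp (-(κ * C.d X))) Cw (vol os) Λ K)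
    (hRSA : ∀ os K t, |t| ≤ l₀ → ∀ τ ∈ T os K \ Bad os K t, ∀ v ∈ Adm, ∀ j ≤ K,
      |∑ X ∈ rfac os K t τ with C.scale X = j, (RA (gA K) (uA K v) X - RA (gA K) oneA X)|
        ≤ vol os * (R₁ * gsA K j ^ κ₀))
    (hRSB : ∀ os K t, |t| ≤ l₀ → ∀ τ ∈ T os K \ Bad os K t, ∀ v ∈ Adm, ∀ j ≤ K,
      |∑ X ∈ rfac os K t τ with C.scale X = j, (RB (gB K) (uB K v) X - RB (gB K) oneB X)|
        ≤ vol os * (R₁ * gsB K j ^ κ₀))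
    (hb : 0 < b) (h031A : ∀ K, Step.Discrete031 b β' K (gfA K) (gsA K))
    (h031B : ∀ K, Step.Discrete031 b β' K (gfB K) (gsB K)) (hgsA : ∀ K k, k ≤ K → 0 ≤ gsA K k)
    (hgsB : ∀ K k, k ≤ K → 0 ≤ gsB K k) (hR₁ : 0 ≤ R₁) (hκ₀ : 4 < κ₀)
    -- the residual-proper kind
    (hrpos : ∀ os K t, |t| ≤ l₀ → ∀ τ ∈ T os K \ Bad os K t, ∀ v ∈ Adm, 0 < rA os K t τ v ∧ 0 < rB os K t τ v)
    (hR : ∀ os K t, |t| ≤ l₀ → ∀ τ ∈ T os K \ Bad os K t, ∀ v ∈ Adm,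
      |Real.log (rB os K t τ v) - Real.log (rA os K t τ v) - cR os K t τ| ≤ RR os K t τ)
    (hRR : ∀ os K t, |t| ≤ l₀ → ∀ τ ∈ T os K \ Bad os K t, RR os K t τ ≤ vol os * rR os K)
    (hrR : ∀ os, Summable (rR os))
    (hdevR : ∀ os, ∃ c₀ s : ℕ → ℝ, Summable s ∧
      ∀ K t, |t| ≤ l₀ → ∀ τ ∈ T os K \ Bad os K t, |cR os K t τ - c₀ K| ≤ vol os * s K)
    (hW : ∀ os, T4WeightBudget.RelWeightBound l₀ (T os) (A os) (B os) (Bad os) (Wb os))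
    (hA : ∀ os K t, |t| ≤ l₀ → ∀ τ ∈ T os K, 0 ≤ A os K t τ)
    (hB : ∀ os K t, |t| ≤ l₀ → ∀ τ ∈ T os K, 0 ≤ B os K t τ)
    (hZA : ∀ os K t, |t| ≤ l₀ → T4GenFunBounds.schemeZ Sc os (K₀ os + K) t = ∑ τ ∈ T os K, A os K t τ)
    (hZB : ∀ os K t, |t| ≤ l₀ → T4GenFunBounds.schemeZ Sc os (K₀ os + K + 1) t = ∑ τ ∈ T os K, B os K t τ) :
    HasContinuumLimit Sc ∧ HasUniqueLimitPoints Sc ∧ LimitPointsAgree Sc := by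
  -- the residual split per string, good term and admissible datum (§1 + §3)
  have hsplit : ∀ os K t, |t| ≤ l₀ → ∀ τ ∈ T os K \ Bad os K t, ∀ v ∈ Adm,
      0 < (∏ X ∈ rfac os K t τ, Real.exp (RA (gA K) (uA K v) X - RA (gA K) oneA X)) * rA os K t τ v ∧
      0 < (∏ X ∈ rfac os K t τ, Real.exp (RB (gB K) (uB K v) X - RB (gB K) oneB X)) * rB os K t τ v ∧
      |Real.log ((∏ X ∈ rfac os K t τ, Real.exp (RB (gB K) (uB K v) X - RB (gB K) oneB X)) * rB os K t τ v)
          - Real.log ((∏ X ∈ rfac os K t τ, Real.exp (RA (gA K) (uA K v) X - RA (gA K) oneA X)) * rA os K t τ v)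
          - cR os K t τ|
        ≤ vol os * (max (2 * Cw) 1 * ((∑ p ∈ antidiagonal K, min (R₁ * gsA K p.1 ^ κ₀) (CrR * θ' ^ p.1 * Λ ^ p.2))
            + ∑ p ∈ antidiagonal K, min (R₁ * gsB K p.1 ^ κ₀) (CrR * θ' ^ p.1 * Λ ^ p.2))) + RR os K t τ := by
    intro os K t ht τ hτ v hv
    obtain ⟨v₁, hv₁, hA1, hB1⟩ := hwit K
    have hρ := (rGroup_logRatio_le (C := C.toCarriers) (hURR K) hCrR hθ'0.le (hrsc os K t ht τ hτ)
      (hMR os K t ht τ hτ) hv₁ hA1 hB1 (hRSA os K t ht τ hτ) (hRSB os K t ht τ hτ) hv).trans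
      (rRadius_le (hvol os).le hR₁ (hgsA K) (hgsB K) hCrR hθ'0.le (zero_le_one.trans hΛ1))
    exact residual_split_pointwise (rGroup_pos (C := C.toCarriers) RA (gA K) (uA K v) oneA (rfac os K t τ))
      (rGroup_pos (C := C.toCarriers) RB (gB K) (uB K v) oneB (rfac os K t τ)) (hrpos os K t ht τ hτ v hv).1
      (hrpos os K t ht τ hτ v hv).2 hρ (hR os K t ht τ hτ v hv)
  have hrρ := summable_rRadius (Cw := Cw) hb h031A h031B hgsA hgsB hR₁ hCrR hθ'0 hθ'1 hθ'Λ hκ₀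
  exact hasContinuumLimit_of_kinds_rate_witness
    (rA := fun os K t τ v => (∏ X ∈ rfac os K t τ, Real.exp (RA (gA K) (uA K v) X - RA (gA K) oneA X))
      * rA os K t τ v)
    (rB := fun os K t τ v => (∏ X ∈ rfac os K t τ, Real.exp (RB (gB K) (uB K v) X - RB (gB K) oneB X))
      * rB os K t τ v)
    (RR := fun os K t τ => vol os * (max (2 * Cw) 1 * ((∑ p ∈ antidiagonal K, min (R₁ * gsA K p.1 ^ κ₀)
        (CrR * θ' ^ p.1 * Λ ^ p.2)) + ∑ p ∈ antidiagonal K, min (R₁ * gsB K p.1 ^ κ₀) (CrR * θ' ^ p.1 * Λ ^ p.2)))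
      + RR os K t τ)
    (rR := fun os K => max (2 * Cw) 1 * ((∑ p ∈ antidiagonal K, min (R₁ * gsA K p.1 ^ κ₀) (CrR * θ' ^ p.1 * Λ ^ p.2))
        + ∑ p ∈ antidiagonal K, min (R₁ * gsB K p.1 ^ κ₀) (CrR * θ' ^ p.1 * Λ ^ p.2)) + rR os K)
    Sc hβ hm h1 hl₀ hUR hCr hθ'0 hθ'1 hθ'Λ hΛ1 hCl hE ha0 ha1 hURB hEB₀ hwit hvol hfmtA hfmtB hint hsc hoff hS hM hSle
    hpend hBwin hMB hnpos hzA hzB hzAs hzBs hq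
    (fun os K t ht τ hτ v hv => ⟨(hsplit os K t ht τ hτ v hv).1, (hsplit os K t ht τ hτ v hv).2.1⟩)
    (fun os K t ht τ hτ v hv => (hsplit os K t ht τ hτ v hv).2.2)
    (fun os K t ht τ hτ => by
      have h1 := hRR os K t ht τ hτ
      rw [mul_add]; linarith)
    (fun os => hrρ.add (hrR os)) hdevR hW hA hB hZA hZB

/-- **ALL STRINGS, END TO END, ON THE t-CURRENCY TOWERS — the term-wise route's capstone from the sibling nodes' typed
outputs with the 𝐑-kind resolved.**  As generation 6's `T4TermwiseBoundary.hasContinuumLimit_of_kinds_nodesT` (node U3's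
E-shapes on `Wt`, node U3.B's boundary shapes on `WB`, NE3 + liaison, node U2's output `InjectedRate Cd 0 θc (disc g_K
g_{K+1})` AS IS, both runs' t-tables in the windows), PLUS node-U3-type shapes for the 𝐑-FUNCTIONALS `Rt`, `RBt` of the
t-history on a t-window `WR` — `NE9 Rt WR κ ΛR` with `FadingMemory C₉R ωR ΛR`, `LipBackground Rt WR κ CUR` with
`PolyLipGrowth CUR (1/g_K²) PR qR′`, `NE5 Rt RBt WR κ θ₅R C₅R` (ALL NOT PRINTED; print locates only their one-run
analyticity input: properties (i)–(iii) after (2.27) p. 259 hold for the 𝐑-terms, p. 260), both t-tables in `WR` —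
composed along the tower by generation 5's `T4TermwiseCurrency.uRateUpTo_of_nodesT` VERBATIM at the common rate `θ′`; the
flow window (0.31) `Step.Discrete031 b β′ K (gf K) (g K)` of the scheme's coupling tables at EVERY cutoff (the BetaPertH
road, BY NAME; run B's table `j ↦ g_{K+1,j+1}` gets its window by §0), nonnegative couplings, `0 ≤ R₁`, `4 < κ₀`; the
per-string binders of `hasContinuumLimit_of_kindsR_rate_witness` with the slice sizes (R-S) read on the tables `g_{K,j}`,
`g_{K+1,j+1}`.  CONCLUSION: node U0's three targets.  HONEST FRAMING: fixed finite torus, rung (B)+1, CONDITIONAL on every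
binder named — NE7 NOT PRINTED, the upstream conditionals inside the producers of `hinj` / the weight half as those modules
name them, (0.31) here by name; nothing here is infinite volume, a mass gap, or the Clay problem. [folklore] -/
theorem hasContinuumLimit_of_kindsR_nodesT [RegularGaugeGroup G] {σ : List O → Type} [∀ os, DecidableEq (σ os)]
    {R : Readings ι X} {Wt WB WR : Set (ℕ → ℝ)} {Et : Functional C.toCarriers C.BgA}
    {EBt : Functional C.toCarriers C.BgB} {Rt : Functional C.toCarriers C.BgA} {RBt : Functional C.toCarriers C.BgB}
    {θ₅ C₅ C₉ ω θc Cd C₃ θ₃ P θ₅B C₅B C₉B ωB PB θ₅R C₅R C₉R ωR PR : ℝ} {q qB' qR' : ℕ}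
    {Λm ΛB ΛR : ℕ → ℕ → ℝ} {CU CUB CUR : (ℕ → ℝ) → ℕ → ℝ} {g : ℕ → ℕ → ℝ} {gf : ℕ → ℝ}
    {l₀ : ℝ} {vol : List O → ℝ} {K₀ : List O → ℕ} {T : (os : List O) → ℕ → Finset (σ os)}
    {Bad : (os : List O) → ℕ → ℝ → Finset (σ os)} {A B : (os : List O) → ℕ → ℝ → σ os → ℝ}
    {μ : (os : List O) → ℕ → ℝ → σ os → Measure ι} {fac bfac rfac : (os : List O) → ℕ → ℝ → σ os → Finset C.Dom}
    {pend : (os : List O) → ℕ → ℝ → σ os → ι → C.Fl} {nA nB rA rB : (os : List O) → ℕ → ℝ → σ os → ι → ℝ}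
    {qA qB : List O → ℕ → ℝ} {κ₁ S : (os : List O) → ℕ → ℝ → σ os → ℕ → ℝ}
    {cR RR : (os : List O) → ℕ → ℝ → σ os → ℝ} {rR zA zB Wb : List O → ℕ → ℝ}
    (Sc : TorusScheme G O) (hβ : ∀ K, 0 ≤ Sc.β K) (hm : ∀ K o, Measurable (Sc.obs K o))
    (h1 : ∀ K o U, |Sc.obs K o U| ≤ 1) (hl₀ : 0 < l₀)
    -- node U3 (E-group) on the t-window, NE3 + liaison, node U2's output
    (h9 : NE9 Et Wt κ Λm) (hΛm : FadingMemory C₉ ω Λm) (hω : 0 ≤ ω)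
    (hUL : LipBackground Et Wt κ CU) (hG : PolyLipGrowth CU (fun K n => invSq (g K n)) P q) (hP : 0 ≤ P)
    (h5 : NE5 Et EBt Wt κ θ₅ C₅) (hθ₅ : 0 ≤ θ₅) (hC₅ : 0 ≤ C₅)
    (hloc : LocalRate R C₃ θ₃) (hC₃ : 0 ≤ C₃) (hθ₃ : 0 ≤ θ₃) (hθ₃1 : θ₃ < 1) (hgd : GaugeDominated R uA uB)
    (hinj : InjectedRate Cd 0 θc (fun K j => T4CouplingMatching.disc (g K) (g (K + 1)) j)) (hCd : 0 ≤ Cd)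
    (hθc : 0 ≤ θc) (htA : ∀ K, (fun n => invSq (g K n)) ∈ Wt)
    (htB : ∀ K, (fun n => invSq (g (K + 1) (n + 1))) ∈ Wt)
    (hθ' : max ω θc < θ') (hθ₅' : θ₅ ≤ θ') (hθ₃' : θ₃ ≤ θ')
    -- node U3.B (boundary group) on its t-window
    (h9B : NE9Fl BA WB κ ΛB) (hΛB : FadingMemory C₉B ωB ΛB) (hωB : 0 ≤ ωB)
    (hULB : LipBackgroundFl BA WB κ CUB) (hGB : PolyLipGrowth CUB (fun K n => invSq (g K n)) PB qB')
    (hPB : 0 ≤ PB) (h5B : NE5B BA BB WB κ θ₅B C₅B) (hθ₅B : 0 ≤ θ₅B) (hC₅B : 0 ≤ C₅B)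
    (htAB : ∀ K, (fun n => invSq (g K n)) ∈ WB) (htBB : ∀ K, (fun n => invSq (g (K + 1) (n + 1))) ∈ WB)
    (hθ'B : max ωB θc < θ') (hθ₅B' : θ₅B ≤ θ')
    -- node U3.R (the 𝐑-functionals) on its t-window
    (h9R : NE9 Rt WR κ ΛR) (hΛR : FadingMemory C₉R ωR ΛR) (hωR : 0 ≤ ωR)
    (hULR : LipBackground Rt WR κ CUR) (hGR : PolyLipGrowth CUR (fun K n => invSq (g K n)) PR qR') (hPR : 0 ≤ PR)
    (h5R : NE5 Rt RBt WR κ θ₅R C₅R) (hθ₅R : 0 ≤ θ₅R) (hC₅R : 0 ≤ C₅R)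
    (htAR : ∀ K, (fun n => invSq (g K n)) ∈ WR) (htBR : ∀ K, (fun n => invSq (g (K + 1) (n + 1))) ∈ WR)
    (hθ'R : max ωR θc < θ') (hθ₅R' : θ₅R ≤ θ')
    (hE : 0 ≤ E) (ha0 : 0 < a) (ha1 : a < 1) (hθ'1 : θ' < 1) (hθ'Λ : θ' ≤ Λ) (hΛ1 : 1 ≤ Λ) (hCl : 0 ≤ Cl)
    (hwit : ∀ K, ∃ v₁ ∈ R.dom, uA K v₁ = oneA ∧ uB K v₁ = oneB)
    (hvol : ∀ os, 0 < vol os)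
    (hfmtA : ∀ os K t τ, A os K t τ = ∫ v, (∏ X ∈ fac os K t τ,
      Real.exp (Et (fun n => invSq (g K n)) (uA K v) X - Et (fun n => invSq (g K n)) oneA X)) *
        ((∏ X ∈ bfac os K t τ, Real.exp (BA (fun n => invSq (g K n)) (uA K v) (pend os K t τ v) X))
          * nA os K t τ v * qA os K
          * ((∏ X ∈ rfac os K t τ, Real.exp (Rt (fun n => invSq (g K n)) (uA K v) X
              - Rt (fun n => invSq (g K n)) oneA X)) * rA os K t τ v)) ∂(μ os K t τ))
    (hfmtB : ∀ os K t τ, B os K t τ = ∫ v, (∏ X ∈ fac os K t τ,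
      Real.exp (EBt (fun n => invSq (g (K + 1) (n + 1))) (uB K v) X
        - EBt (fun n => invSq (g (K + 1) (n + 1))) oneB X)) *
        ((∏ X ∈ bfac os K t τ, Real.exp (BB (fun n => invSq (g (K + 1) (n + 1))) (uB K v) (pend os K t τ v) X))
          * nB os K t τ v * qB os K
          * ((∏ X ∈ rfac os K t τ, Real.exp (RBt (fun n => invSq (g (K + 1) (n + 1))) (uB K v) X
              - RBt (fun n => invSq (g (K + 1) (n + 1))) oneB X)) * rB os K t τ v)) ∂(μ os K t τ))
    (hint : ∀ os K t, |t| ≤ l₀ → ∀ τ ∈ T os K \ Bad os K t,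
      Integrable (fun v => (∏ X ∈ fac os K t τ,
        Real.exp (Et (fun n => invSq (g K n)) (uA K v) X - Et (fun n => invSq (g K n)) oneA X)) *
        ((∏ X ∈ bfac os K t τ, Real.exp (BA (fun n => invSq (g K n)) (uA K v) (pend os K t τ v) X))
          * nA os K t τ v * qA os K
          * ((∏ X ∈ rfac os K t τ, Real.exp (Rt (fun n => invSq (g K n)) (uA K v) X
              - Rt (fun n => invSq (g K n)) oneA X)) * rA os K t τ v))) (μ os K t τ) ∧
      Integrable (fun v => (∏ X ∈ fac os K t τ,
        Real.exp (EBt (fun n => invSq (g (K + 1) (n + 1))) (uB K v) X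
          - EBt (fun n => invSq (g (K + 1) (n + 1))) oneB X)) *
        ((∏ X ∈ bfac os K t τ, Real.exp (BB (fun n => invSq (g (K + 1) (n + 1))) (uB K v) (pend os K t τ v) X))
          * nB os K t τ v * qB os K
          * ((∏ X ∈ rfac os K t τ, Real.exp (RBt (fun n => invSq (g (K + 1) (n + 1))) (uB K v) X
              - RBt (fun n => invSq (g (K + 1) (n + 1))) oneB X)) * rB os K t τ v))) (μ os K t τ))
    (hsc : ∀ os K t, |t| ≤ l₀ → ∀ τ ∈ T os K \ Bad os K t, ∀ X ∈ fac os K t τ, C.scale X ≤ K)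
    (hoff : ∀ os K t, |t| ≤ l₀ → ∀ τ ∈ T os K \ Bad os K t, ∀ v, v ∉ R.dom →
      (∏ X ∈ fac os K t τ,
        Real.exp (Et (fun n => invSq (g K n)) (uA K v) X - Et (fun n => invSq (g K n)) oneA X)) *
        ((∏ X ∈ bfac os K t τ, Real.exp (BA (fun n => invSq (g K n)) (uA K v) (pend os K t τ v) X))
          * nA os K t τ v * qA os K
          * ((∏ X ∈ rfac os K t τ, Real.exp (Rt (fun n => invSq (g K n)) (uA K v) X
              - Rt (fun n => invSq (g K n)) oneA X)) * rA os K t τ v)) = 0 ∧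
      (∏ X ∈ fac os K t τ,
        Real.exp (EBt (fun n => invSq (g (K + 1) (n + 1))) (uB K v) X
          - EBt (fun n => invSq (g (K + 1) (n + 1))) oneB X)) *
        ((∏ X ∈ bfac os K t τ, Real.exp (BB (fun n => invSq (g (K + 1) (n + 1))) (uB K v) (pend os K t τ v) X))
          * nB os K t τ v * qB os K
          * ((∏ X ∈ rfac os K t τ, Real.exp (RBt (fun n => invSq (g (K + 1) (n + 1))) (uB K v) X
              - RBt (fun n => invSq (g (K + 1) (n + 1))) oneB X)) * rB os K t τ v)) = 0)
    (hS : ∀ os K t, |t| ≤ l₀ → ∀ τ ∈ T os K \ Bad os K t, ∀ v ∈ R.dom, ∀ j ≤ K,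
      |(∑ X ∈ fac os K t τ with C.scale X = j,
          (Real.log (Real.exp (EBt (fun n => invSq (g (K + 1) (n + 1))) (uB K v) X
              - EBt (fun n => invSq (g (K + 1) (n + 1))) oneB X))
            - Real.log (Real.exp (Et (fun n => invSq (g K n)) (uA K v) X
              - Et (fun n => invSq (g K n)) oneA X)))) - κ₁ os K t τ j| ≤ S os K t τ j)
    (hM : ∀ os K t, |t| ≤ l₀ → ∀ τ ∈ T os K \ Bad os K t,
      Multiplicity (fac os K t τ) C.scale (fun X => Real.exp (-(κ * C.d X))) Cw (vol os) Λ K)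
    (hSle : ∀ os K t, |t| ≤ l₀ → ∀ τ ∈ T os K \ Bad os K t, ∀ j ≤ K,
      S os K t τ j ≤ vol os * (E * a ^ (K - j)))
    (hpend : ∀ os K t, |t| ≤ l₀ → ∀ τ ∈ T os K \ Bad os K t, ∀ v ∈ R.dom, pend os K t τ v ∈ C.admFl)
    (hBwin : ∀ os K t, |t| ≤ l₀ → ∀ τ ∈ T os K \ Bad os K t, RecentOnly (bfac os K t τ) C.scale (jlogOf Cl K) K)
    (hMB : ∀ os K t, |t| ≤ l₀ → ∀ τ ∈ T os K \ Bad os K t,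
      Multiplicity (bfac os K t τ) C.scale (fun X => Real.exp (-(κ * C.d X))) Cw (vol os) Λ K)
    (hnpos : ∀ os K t, |t| ≤ l₀ → ∀ τ ∈ T os K \ Bad os K t, ∀ v ∈ R.dom, 0 < nA os K t τ v ∧ 0 < nB os K t τ v)
    (hzA : ∀ os K t, |t| ≤ l₀ → ∀ τ ∈ T os K \ Bad os K t, ∀ v ∈ R.dom,
      |Real.log (nA os K t τ v)| ≤ vol os * zA os K)
    (hzB : ∀ os K t, |t| ≤ l₀ → ∀ τ ∈ T os K \ Bad os K t, ∀ v ∈ R.dom,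
      |Real.log (nB os K t τ v)| ≤ vol os * zB os K)
    (hzAs : ∀ os, Summable (zA os)) (hzBs : ∀ os, Summable (zB os))
    (hq : ∀ os K, 0 < qA os K ∧ 0 < qB os K)
    -- the 𝐑-kind per string: scales, multiplicity, one-run slice sizes on the coupling tables; the flow window
    (hrsc : ∀ os K t, |t| ≤ l₀ → ∀ τ ∈ T os K \ Bad os K t, ∀ X ∈ rfac os K t τ, C.scale X ≤ K)
    (hMR : ∀ os K t, |t| ≤ l₀ → ∀ τ ∈ T os K \ Bad os K t,
      Multiplicity (rfac os K t τ) C.scale (fun X => Real.exp (-(κ * C.d X))) Cw (vol os) Λ K)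
    (hRSA : ∀ os K t, |t| ≤ l₀ → ∀ τ ∈ T os K \ Bad os K t, ∀ v ∈ R.dom, ∀ j ≤ K,
      |∑ X ∈ rfac os K t τ with C.scale X = j,
          (Rt (fun n => invSq (g K n)) (uA K v) X - Rt (fun n => invSq (g K n)) oneA X)|
        ≤ vol os * (R₁ * g K j ^ κ₀))
    (hRSB : ∀ os K t, |t| ≤ l₀ → ∀ τ ∈ T os K \ Bad os K t, ∀ v ∈ R.dom, ∀ j ≤ K,
      |∑ X ∈ rfac os K t τ with C.scale X = j,
          (RBt (fun n => invSq (g (K + 1) (n + 1))) (uB K v) X - RBt (fun n => invSq (g (K + 1) (n + 1))) oneB X)|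
        ≤ vol os * (R₁ * g (K + 1) (j + 1) ^ κ₀))
    (hb : 0 < b) (h031 : ∀ K, Step.Discrete031 b β' K (gf K) (g K)) (hgpos : ∀ K k, k ≤ K → 0 ≤ g K k)
    (hR₁ : 0 ≤ R₁) (hκ₀ : 4 < κ₀)
    -- the residual-proper kind
    (hrpos : ∀ os K t, |t| ≤ l₀ → ∀ τ ∈ T os K \ Bad os K t, ∀ v ∈ R.dom, 0 < rA os K t τ v ∧ 0 < rB os K t τ v)
    (hR : ∀ os K t, |t| ≤ l₀ → ∀ τ ∈ T os K \ Bad os K t, ∀ v ∈ R.dom,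
      |Real.log (rB os K t τ v) - Real.log (rA os K t τ v) - cR os K t τ| ≤ RR os K t τ)
    (hRR : ∀ os K t, |t| ≤ l₀ → ∀ τ ∈ T os K \ Bad os K t, RR os K t τ ≤ vol os * rR os K)
    (hrR : ∀ os, Summable (rR os))
    (hdevR : ∀ os, ∃ c₀ s : ℕ → ℝ, Summable s ∧
      ∀ K t, |t| ≤ l₀ → ∀ τ ∈ T os K \ Bad os K t, |cR os K t τ - c₀ K| ≤ vol os * s K)
    (hW : ∀ os, T4WeightBudget.RelWeightBound l₀ (T os) (A os) (B os) (Bad os) (Wb os))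
    (hA : ∀ os K t, |t| ≤ l₀ → ∀ τ ∈ T os K, 0 ≤ A os K t τ)
    (hB : ∀ os K t, |t| ≤ l₀ → ∀ τ ∈ T os K, 0 ≤ B os K t τ)
    (hZA : ∀ os K t, |t| ≤ l₀ → T4GenFunBounds.schemeZ Sc os (K₀ os + K) t = ∑ τ ∈ T os K, A os K t τ)
    (hZB : ∀ os K t, |t| ≤ l₀ → T4GenFunBounds.schemeZ Sc os (K₀ os + K + 1) t = ∑ τ ∈ T os K, B os K t τ) :
    HasContinuumLimit Sc ∧ HasUniqueLimitPoints Sc ∧ LimitPointsAgree Sc := by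
  obtain ⟨a₀, ha₀, hUK⟩ := uRateUpTo_of_nodesT h9 hΛm hω hUL hG hP h5 hθ₅ hC₅ hloc hC₃ hθ₃ hθ₃1 hgd hinj hCd hθc
    htA htB hθ' hθ₅' hθ₃'
  obtain ⟨b₀, hb₀, hUKB⟩ := uRateUpToFl_of_nodesT h9B hΛB hωB hULB hGB hPB h5B hθ₅B hC₅B hloc hC₃ hθ₃ hθ₃1 hgd hinj
    hCd hθc htAB htBB hθ'B hθ₅B' hθ₃'
  obtain ⟨r₀, hr₀, hUKR⟩ := uRateUpTo_of_nodesT h9R hΛR hωR hULR hGR hPR h5R hθ₅R hC₅R hloc hC₃ hθ₃ hθ₃1 hgd hinj hCd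
    hθc htAR htBR hθ'R hθ₅R' hθ₃'
  have hθ'0 : 0 < θ' := lt_of_le_of_lt (hθc.trans (le_max_right ω θc)) hθ'
  have hC₉ : 0 ≤ C₉ := T4BetaReadOut.fadingMemory_const_nonneg hΛm
  have hC₉B : 0 ≤ C₉B := T4BetaReadOut.fadingMemory_const_nonneg hΛB
  have hC₉R : 0 ≤ C₉R := T4BetaReadOut.fadingMemory_const_nonneg hΛR
  have hCr : 0 ≤ a₀ + C₉ * Cd * (θ' / (θ' - max ω θc)) + C₅ :=
    add_nonneg (add_nonneg ha₀ (mul_nonneg (mul_nonneg hC₉ hCd) (div_nonneg hθ'0.le (sub_pos.mpr hθ').le))) hC₅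
  have hEB₀ : 0 ≤ b₀ + C₉B * Cd * (θ' / (θ' - max ωB θc)) + C₅B :=
    add_nonneg (add_nonneg hb₀ (mul_nonneg (mul_nonneg hC₉B hCd) (div_nonneg hθ'0.le (sub_pos.mpr hθ'B).le))) hC₅B
  have hCrR : 0 ≤ r₀ + C₉R * Cd * (θ' / (θ' - max ωR θc)) + C₅R :=
    add_nonneg (add_nonneg hr₀ (mul_nonneg (mul_nonneg hC₉R hCd) (div_nonneg hθ'0.le (sub_pos.mpr hθ'R).le))) hC₅R
  -- run B's coupling table `j ↦ g_{K+1,j+1}` inherits the flow window (§0) and nonnegativity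
  have h031B : ∀ K, Step.Discrete031 b β' K (gf (K + 1)) (fun j => g (K + 1) (j + 1)) :=
    fun K => discrete031_reindex (h031 (K + 1))
  have hgposB : ∀ K k, k ≤ K → 0 ≤ g (K + 1) (k + 1) := fun K k hk => hgpos (K + 1) (k + 1) (by omega)
  exact hasContinuumLimit_of_kindsR_rate_witness (Adm := R.dom) (gsA := g) (gsB := fun K j => g (K + 1) (j + 1))
    (gfA := gf) (gfB := fun K => gf (K + 1)) Sc hβ hm h1 hl₀ hUK hCr hθ'0 hθ'1 hθ'Λ hΛ1 hCl hE ha0 ha1 hUKB hEB₀ hUKR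
    hCrR hwit hvol hfmtA hfmtB hint hsc hoff hS hM hSle hpend hBwin hMB hnpos hzA hzB hzAs hzBs hq hrsc hMR hRSA hRSB hb
    h031 h031B hgpos hgposB hR₁ hκ₀ hrpos hR hRR hrR hdevR hW hA hB hZA hZB

end Scheme


/-! ## §6 Sanity: §1's binders jointly inhabited with background-dependent, run-dependent 𝐑-terms -/

section Toy

/-- NON-VACUITY OF THE 𝐑-KIND'S BINDERS (no physics).  One domain `X₀` of scale `0` and tree length `0`; TWO backgrounds
per run (`Bool`, reference background `false`); the two runs' 𝐑-terms DIFFERENT and background-dependent, `𝐑^A(X₀; U) =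
[U = true]`, `𝐑^B(X₀; U) = ½[U = true]`; driving fields `v : Bool` with `U^A(v) = U^B(v) = v`, everything admissible, witness
`v₁ = false`.  Then the 𝐑-rate (R-T) holds at cutoff `0` with `C_R = ½` (rate `θ = ½`, `κ = 0`), the multiplicity (M-R)
with `Cw = vol = 1`, `Λ = 2`, the one-run slice sizes (R-S) with `R₁ = 1`, tables `g ≡ 1`, `κ₀ = 7`; the genuine two-run
log-ratio of the 𝐑-groups at `v = true` is `−½ ≠ 0`, and `rGroup_logRatio_le` bounds it by the produced radius
`min(1 + 1, 2·½) = 1`.  So the binder shapes consumed in §4–§5 are jointly satisfiable with a non-trivial 𝐑-group.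
[folklore] -/
theorem toy_rKind_nonvacuous :
    let C : Carriers :=
      { Dom := Unit, scale := fun _ => 0, d := fun _ => 0, d_nonneg := fun _ => le_rfl, BgA := Bool, BgB := Bool,
        gauge := fun _ _ => 0, gauge_nonneg := fun _ _ => le_rfl, transport := fun U => U }
    let RA : Functional C Bool := fun _ U _ => if U = true then 1 else 0
    let RB : Functional C Bool := fun _ U _ => if U = true then 1 / 2 else 0
    let X₀ : C.Dom := ()
    URateUpTo (C := C) 0 RA RB (fun _ => 1) (fun _ => 1) (fun v : Bool => v) (fun v : Bool => v) Set.univ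
        (1 / 2) (1 / 2) 0 ∧
      Multiplicity ({X₀} : Finset C.Dom) C.scale (fun X => Real.exp (-(0 * C.d X))) 1 1 2 0 ∧
      (∀ v ∈ (Set.univ : Set Bool), ∀ j ≤ 0,
        |∑ X ∈ ({X₀} : Finset C.Dom) with C.scale X = j, (RA (fun _ => 1) v X - RA (fun _ => 1) false X)|
          ≤ 1 * (1 * (1 : ℝ) ^ 7)) ∧
      (∀ v ∈ (Set.univ : Set Bool), ∀ j ≤ 0,
        |∑ X ∈ ({X₀} : Finset C.Dom) with C.scale X = j, (RB (fun _ => 1) v X - RB (fun _ => 1) false X)|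
          ≤ 1 * (1 * (1 : ℝ) ^ 7)) ∧
      Real.log (∏ X ∈ ({X₀} : Finset C.Dom), Real.exp (RB (fun _ => 1) true X - RB (fun _ => 1) false X))
          - Real.log (∏ X ∈ ({X₀} : Finset C.Dom), Real.exp (RA (fun _ => 1) true X - RA (fun _ => 1) false X))
        = -(1 / 2) ∧
      |Real.log (∏ X ∈ ({X₀} : Finset C.Dom), Real.exp (RB (fun _ => 1) true X - RB (fun _ => 1) false X))
          - Real.log (∏ X ∈ ({X₀} : Finset C.Dom), Real.exp (RA (fun _ => 1) true X - RA (fun _ => 1) false X)) - 0|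
        ≤ ∑ j ∈ range (0 + 1), min (1 * (1 * (1 : ℝ) ^ 7) + 1 * (1 * (1 : ℝ) ^ 7))
            (2 * (1 * 1 * (1 / 2 * (1 / 2 : ℝ) ^ j * 2 ^ (0 - j)))) := by
  intro C RA RB X₀
  have hs0 : ∀ X : C.Dom, C.scale X = 0 := fun _ => rfl
  have hd0 : ∀ X : C.Dom, C.d X = 0 := fun _ => rfl
  have hX : ∀ X : C.Dom, X = X₀ := fun _ => rfl
  have hURR : URateUpTo (C := C) 0 RA RB (fun _ => 1) (fun _ => 1) (fun v : Bool => v) (fun v : Bool => v) Set.univ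
      (1 / 2) (1 / 2) 0 := by
    intro v _ X _
    rw [hs0, hd0]
    cases v <;> norm_num [RA, RB]
  have hM : Multiplicity ({X₀} : Finset C.Dom) C.scale (fun X => Real.exp (-(0 * C.d X))) 1 1 2 0 := by
    intro j hj
    obtain rfl : j = 0 := Nat.le_zero.mp hj
    simp [hs0]
  have hsc : ∀ X ∈ ({X₀} : Finset C.Dom), C.scale X ≤ 0 := fun X _ => (hs0 X).le
  have hRSA : ∀ v ∈ (Set.univ : Set Bool), ∀ j ≤ 0,
      |∑ X ∈ ({X₀} : Finset C.Dom) with C.scale X = j, (RA (fun _ => 1) v X - RA (fun _ => 1) false X)|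
        ≤ 1 * (1 * (1 : ℝ) ^ 7) := by
    intro v _ j hj
    obtain rfl : j = 0 := Nat.le_zero.mp hj
    cases v <;> norm_num [RA, hs0]
  have hRSB : ∀ v ∈ (Set.univ : Set Bool), ∀ j ≤ 0,
      |∑ X ∈ ({X₀} : Finset C.Dom) with C.scale X = j, (RB (fun _ => 1) v X - RB (fun _ => 1) false X)|
        ≤ 1 * (1 * (1 : ℝ) ^ 7) := by
    intro v _ j hj
    obtain rfl : j = 0 := Nat.le_zero.mp hj
    cases v <;> norm_num [RB, hs0]
  refine ⟨hURR, hM, hRSA, hRSB, by norm_num [RA, RB, Real.log_exp], ?_⟩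
  exact rGroup_logRatio_le (V := Bool) hURR (by norm_num) (by norm_num) hsc hM (Set.mem_univ false) rfl rfl hRSA hRSB
    (Set.mem_univ true)

end Toy

end Literature.MathematicalPhysics.QuantumFieldTheory.Balaban1983to89.T4TermwiseResidual
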